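import Literature.Probability.Percolation.FiveArmInnerWalk
import Literature.Probability.Percolation.ColourSwitching
import Literature.Probability.Percolation.TriHexLemma
import HarnessLib

/-!
# The inner colour switching for plain five arms (Nolin 2008, Prop. 19): flips, mirror, bounds

Topic `Literature/Probability/Percolation`; family `crit-perc`. PROOFS (and the stopping sets /
flips / mirror data, definitions; no named fact). Nolin's inner colour exchange — "if we fix
some `j` and two arms `r_j, r_{j+1}` of colours `σ_j ≠ σ_{j+1}`, we can choose the colours of
the other arms arbitrarily without changing the probability by more than a constant factor",
the exploration starting FROM `∂S_{n₀}`, "conditionally on any set of consecutive arms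
including these two" (P. Nolin, Near-critical percolation in two dimensions, EJP 13 (2008),
§5.1 Prop. 20 and the proof of Thm. 24, five-arm item [arXiv 0711.4948: Prop. 19,
Thm. 23 (iii), pp. 15–17, 26–27]) — made rigorous for PLAIN five arms from a landing tuple of
`∂Λ_m` with white core (`FiveArmPlainArms.lean`, `FiveArmCoreGadget.lean`), on top of the
single-walk package `InnerWalk.walk_package` (`FiveArmInnerWalk.lean`), and turned into the
probability bounds `P ≤ C(m)/n²` for the cyclic arrangement `B W W W B` (here) and, through the
double flip of Part IV, `B W W W W` (`FiveArmInnerDoubleFlip.lean`); the arrangement `B W B W W`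
is `FiveArmEUpper.lean`.

* Part I (`namespace InnerFlip`) — the flip outside the explored set of ONE interface walk:
  `Afl`, `N₁`, `Nfull`, `flip₁`; `isStoppingSet_N₁` (the examined set of the walk is a stopping
  set, `SiteIfaceWalk.examined_congr`), `real_preimage_flip₁` (measure preservation,
  `IsStoppingSet.sitePercolation_half_real_preimage_stopFlip`), `mem_plainArms_of_pathIn`, and
  **`flip₁_mem`**: from plain arms `(B,W,W,W,B)` (the two black landings cyclically adjacent) the
  flipped configuration has plain arms `(B,W,B,B,W)` at the radius `n - 1` from
  `(s₀, rp m k, s₂, s₃, s₄)` for some `i₀ < k < i₂` (black chain kept, white chain kept and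
  re-based at its last ring site, the arms of `s₂, s₃, s₄` flipped — they avoid the explored set
  by the walk package).
* Part II — **`real_plainArms_BB_le`**: `P_{1/2}(plainArms (B,W,W,W,B) (rp m ∘ i) m n) ≤ C(m)/n²`
  (finite energy on the core `2^{|Λ_m|}`, the flip, the union bound over `k`, the flip of all
  colours `real_plainArms_le_not`, re-indexing `plainArms_subset_reindex`, and `FiveArmEUpper`).
* Part III — the transposition `(x₀, x₁) ↦ (x₁, x₀)` (`transposeIso` of the tree) on the rings:
  `transposeIso_ringPt : transposeIso (ringPt k i) = rp k (9k - i)` (it reverses every ring), the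
  mirrored landing indices `mirrorIdx` (a `GadgetIdx`, `gadgetIdx_mirrorIdx`, with
  `transposeIso (s_{π j}) = s'_j` for `π = (1 4)(2 3)`, `transposeIso_sOf`), `transposeCfg` and the
  transport of plain arms and of the white core (`transpose_mem_src`).
* Part IV (`namespace InnerFlip2`) — the DOUBLE flip for `(B,W,W,W,W)`: the second walk is the
  first walk of the transposed configuration, transported back (`N₂`, `Nboth`, `flip₂`,
  `isStoppingSet_Nboth`, `real_preimage_flip₂`), and **`flip₂_mem`**: the flipped configuration
  has plain arms `(B,W,B,B,W)` at the radius `n - 1` from `(s₀, rp m k, s₂, s₃, rp m k')`,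
  `i₀ < k < i₂`, `i₃ < k' < i₀ + 6m`; the two white chains (from `s₀⁺` and from `s₀⁻`) are
  disjoint by the rim separation `rim_separation` with the arms of `s₀` and `s₂`.

## References

* P. Nolin, Near-critical percolation in two dimensions, *Electron. J. Probab.* 13 (2008),
  §5.1 Prop. 20, §5.2 Thm. 24 (arXiv 0711.4948: Prop. 19, Thm. 23 (iii)) [Nolin2008].
* W. Werner, *Lectures on two-dimensional critical percolation*, IAS/Park City Math. Ser. 16
  (2009), §3.2 (colour switching) and First exercise sheet (arXiv 0710.0856) [WernerPCMI2009].

## Mathlib / tree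

Tree: `InnerWalk.col`, `InnerWalk.coreRing`, `InnerWalk.walk_package` (`FiveArmInnerWalk.lean`);
the interface-walk engine `SiteIfaceWalk.lean` (`examined`, `examined_congr`,
`mem_examined_of_traversed`, `traversed_of_mem_examined`, `ne_none_of_traversed`) and
`InnerExplore` (`FiveArmInnerExplore.lean`); `stopFlip`, `IsStoppingSet`,
`IsStoppingSet.sitePercolation_half_real_preimage_stopFlip` (`StoppingSetFlip.lean`); `plainArms`,
`paint`, `coreOf`, `real_plainArms_eq_mul_paint`, `card_coreOf_le`, `determinedBy_plainArms`
(`FiveArmPlainArms.lean`); `Gadget.GadgetIdx`, `Gadget.sOf`, `Gadget.κE`,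
`Gadget.exists_pathIn_trunc` (`FiveArmCoreGadget.lean`); `exists_real_plainArms_E_le`
(`FiveArmEUpper.lean`); `rim_separation` (`RimSeparation.lean`); `transposeIso`, `triSwapIso`,
`triNorm_transposeIso`, `pathIn_map_iso`; the `PathIn` API.
-/

/-! ## Part I — the single flip `(B,W,W,W,B) → (B,W,B,B,W)` -/

noncomputable section

open MeasureTheory Set

namespace Literature.Probability.Percolation

open LatticeModels SiteIface InnerExplore Gadget InnerWalk

namespace InnerFlip

variable (m n : ℕ) (i : Fin 5 → ℕ)

open Classical in
/-- **The flippable sites**: norm in `[m, n-1]`, off the core ring (the landing sites and the sites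
of the annulus up to the radius `n - 1`). [folklore] -/
def Afl : Finset (Site 2) := (triBall (n - 1)).filter fun v => (m : ℤ) ≤ triNorm v ∧ v ∉ coreRing m i

open Classical in
/-- **The examined set of the first walk** (in the flippable sites), with the two ends of the start
bond. [cite: BollobasRiordan2006, Ch. 7 proof of Lemma 6 p. 174] -/
def N₁ (ω : SiteConfig (Site 2)) : Finset (Site 2) :=
  examined (col m n i ω) (inFace m (i 0)) (Afl m n i) ∪ ({rp m (i 0), rp m (i 0 + 1)} ∩ Afl m n i)

/-- **The full unflipped set**: the examined set and every non-flippable site of `Λ_{n-1}`. [folklore] -/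
def Nfull (ω : SiteConfig (Site 2)) : Finset (Site 2) := N₁ m n i ω ∪ (triBall (n - 1) \ Afl m n i)

/-- **The flip**: the states of the flippable unexamined sites are changed. [cite: Nolin2008, §5.1 Prop. 20 (arXiv 0711.4948: Prop. 19)] -/
def flip₁ : SiteConfig (Site 2) → SiteConfig (Site 2) := stopFlip (triBall (n - 1)) (Nfull m n i)

variable {m n i}

/-- Membership in the flippable set. [folklore] -/
theorem mem_Afl {v : Site 2} : v ∈ Afl m n i ↔ ((m : ℤ) ≤ triNorm v ∧ triNorm v ≤ ((n - 1 : ℕ) : ℤ)) ∧ v ∉ coreRing m i := by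
  classical
  unfold Afl
  rw [Finset.mem_filter, mem_triBall_iff]
  tauto

/-- The colouring depends on the configuration only through the flippable sites. [folklore] -/
theorem col_congr {ω ω' : SiteConfig (Site 2)} {v : Site 2} (h : v ∈ Afl m n i → (v ∈ ω ↔ v ∈ ω')) :
    col m n i ω' v = col m n i ω v := by
  unfold col
  split_ifs with h1 h2 h3 h4 h4 <;> try rfl
  · exact absurd ((h (mem_Afl.2 ⟨by omega, h2⟩)).2 h3) h4
  · exact absurd ((h (mem_Afl.2 ⟨by omega, h2⟩)).1 h4) h3

/-- The flippable sites are coloured. [folklore] -/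
theorem col_ne_none_of_mem_Afl (hn : 1 ≤ n) {ω : SiteConfig (Site 2)} {v : Site 2} (hv : v ∈ Afl m n i) : col m n i ω v ≠ none := by
  rw [Ne, col_eq_none_iff]
  obtain ⟨⟨h1, h2⟩, -⟩ := mem_Afl.1 hv
  omega

/-- The start face has no entry side as soon as its apex is grey, unless the bond is an entry side;
in any case the walk stops. [folklore] -/
theorem exists_next_none (hk : 1 ≤ m) (ω : SiteConfig (Site 2)) :
    ∃ t, next (col m n i ω) (walk (col m n i ω) (inFace m (i 0)) t) = none := by
  classical
  have hapex := InnerExplore.triNorm_inFace_apex hk (i 0)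
  set c := col m n i ω
  set F₀ := inFace m (i 0)
  set ι := inIdx m (i 0)
  have hg : c (faceVertex F₀ (ι + 2)) = none := col_eq_none_iff.2 (Or.inl (by omega))
  by_cases hex : ∃ j, IsExit c F₀ j
  · obtain ⟨j, hj⟩ := hex
    refine stops_of_finite (S := triBall n) (fun x hx => ?_) fun j' hE => ?_
    · rw [mem_triBall_iff]
      rw [Ne, col_eq_none_iff] at hx
      omega
    · -- an entry side would have two coloured endpoints, hence be the bond, which is the exit side
      obtain ⟨d, rfl⟩ : ∃ d : Fin 3, j' = ι + d := ⟨j' - ι, by abel⟩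
      obtain ⟨d', rfl⟩ : ∃ d' : Fin 3, j = ι + d' := ⟨j - ι, by abel⟩
      have hE1 := hE.1; have hE2 := hE.2; have hj1 := hj.1; have hj2 := hj.2
      fin_cases d <;> fin_cases d' <;>
        simp only [Fin.zero_eta, add_zero, Fin.mk_one, Fin.reduceFinMk, TriMarkedDomain.fin3_add_one_add_one,
          TriMarkedDomain.fin3_add_one_add_two, TriMarkedDomain.fin3_add_two_add_one,
          TriMarkedDomain.fin3_add_two_add_two] at hE1 hE2 hj1 hj2 <;>
        simp_all
  · refine ⟨0, ?_⟩
    rw [walk_zero]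
    unfold SiteIface.next
    rw [dif_neg hex]

/-- Without exit side at the start, nothing is examined. [folklore] -/
theorem examined_eq_empty {c : Site 2 → Option Bool} {F₀ : HexVertex} {A : Finset (Site 2)} (h : next c F₀ = none) :
    examined c F₀ A = ∅ := by
  classical
  have h0 : ∃ t, next c (walk c F₀ t) = none := ⟨0, by rw [walk_zero]; exact h⟩
  have hlen : len c F₀ = 0 := by
    have := len_le_of_next_eq_none h0 (t := 0) (by rw [walk_zero]; exact h)
    omega
  unfold examined
  rw [hlen, Finset.range_zero, Finset.biUnion_empty]

/-- **The examined set with the bond ends is a stopping set.** [cite: BollobasRiordan2006, Ch. 7 proof of Lemma 6 p. 175] -/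
theorem isStoppingSet_N₁ (hm : 2 ≤ m) (hn : 1 ≤ n) : IsStoppingSet (N₁ m n i) := by
  classical
  have hk : 1 ≤ m := by omega
  intro ω ω' hag
  have hapex := InnerExplore.triNorm_inFace_apex hk (i 0)
  have hfv := faceVertex_inFace hk (i 0)
  set c := col m n i ω with hc
  set c' := col m n i ω' with hc'
  set F₀ := inFace m (i 0)
  set ι := inIdx m (i 0)
  -- agreement off `Afl`, on the examined sites, and at the two bond ends
  have hA : ∀ x, x ∉ Afl m n i → c' x = c x := fun x hx => col_congr fun h => absurd h hx
  have hagX : ∀ x ∈ examined c F₀ (Afl m n i), c' x = c x := fun x hx =>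
    col_congr fun _ => hag x (Finset.mem_union_left _ hx)
  have hends : ∀ x, x = rp m (i 0) ∨ x = rp m (i 0 + 1) → c' x = c x := fun x hx =>
    col_congr fun hxA => hag x (Finset.mem_union_right _ (Finset.mem_inter.2 ⟨by
      rcases hx with rfl | rfl
      · exact Finset.mem_insert_self _ _
      · exact Finset.mem_insert_of_mem (Finset.mem_singleton_self _), hxA⟩))
  have hsame_ends : {rp m (i 0), rp m (i 0 + 1)} ∩ Afl m n i = ({rp m (i 0), rp m (i 0 + 1)} ∩ Afl m n i : Finset (Site 2)) := rfl
  -- the exit sides of the start face agree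
  have hg : c (faceVertex F₀ (ι + 2)) = none := col_eq_none_iff.2 (Or.inl (by omega))
  have hg' : c' (faceVertex F₀ (ι + 2)) = none := col_eq_none_iff.2 (Or.inl (by omega))
  have hexit : ∀ j, IsExit c' F₀ j ↔ IsExit c F₀ j := by
    intro j
    obtain ⟨d, rfl⟩ : ∃ d : Fin 3, j = ι + d := ⟨j - ι, by abel⟩
    have e0 : c' (faceVertex F₀ ι) = c (faceVertex F₀ ι) := hends _ (Or.inl hfv.1)
    have e1 : c' (faceVertex F₀ (ι + 1)) = c (faceVertex F₀ (ι + 1)) := hends _ (Or.inr hfv.2)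
    fin_cases d
    · simp only [Fin.zero_eta, add_zero]
      exact isExit_congr e1 (by rw [hg, hg'])
    · simp only [Fin.mk_one]
      exact isExit_congr (by rw [TriMarkedDomain.fin3_add_one_add_one, hg, hg'])
        (by rw [TriMarkedDomain.fin3_add_one_add_two]; exact e0)
    · simp only [Fin.reduceFinMk]
      exact isExit_congr (by rw [TriMarkedDomain.fin3_add_two_add_one]; exact e0)
        (by rw [TriMarkedDomain.fin3_add_two_add_two]; exact e1)
  show N₁ m n i ω' = N₁ m n i ω
  unfold N₁
  congr 1
  by_cases hex : ∃ j, IsExit c F₀ j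
  · obtain ⟨j₀, hX₀⟩ := hex
    exact examined_congr hA hagX (fun x hx => col_ne_none_of_mem_Afl hn hx) (exists_next_none hk ω) hX₀
  · have hnone : next c F₀ = none := by unfold SiteIface.next; rw [dif_neg hex]
    have hex' : ¬ ∃ j, IsExit c' F₀ j := fun ⟨j, hj⟩ => hex ⟨j, (hexit j).1 hj⟩
    have hnone' : next c' F₀ = none := by unfold SiteIface.next; rw [dif_neg hex']
    rw [examined_eq_empty hnone, examined_eq_empty hnone']

/-- **The full unflipped set is a stopping set** contained in `Λ_{n-1}`. [folklore] -/
theorem isStoppingSet_Nfull (hm : 2 ≤ m) (hn : 1 ≤ n) : IsStoppingSet (Nfull m n i) := by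
  intro ω ω' hag
  unfold Nfull
  rw [isStoppingSet_N₁ hm hn ω ω' fun v hv => hag v (Finset.mem_union_left _ hv)]

/-- `Nfull ⊆ Λ_{n-1}`. [folklore] -/
theorem Nfull_subset (ω : SiteConfig (Site 2)) : Nfull m n i ω ⊆ triBall (n - 1) := by
  classical
  intro v hv
  unfold Nfull N₁ at hv
  simp only [Finset.mem_union, Finset.mem_inter, Finset.mem_sdiff] at hv
  have hA : v ∈ Afl m n i → v ∈ triBall (n - 1) := fun h => (Finset.mem_filter.1 h).1
  rcases hv with (h | ⟨-, h⟩) | ⟨h, -⟩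
  · exact hA (examined_subset h)
  · exact hA h
  · exact h

/-- **The flip preserves `P_{1/2}`** on events determined by `Λ_{n-1}`. [cite: BollobasRiordan2006, Ch. 7 proof of Lemma 6 p. 175] -/
theorem real_preimage_flip₁ (hm : 2 ≤ m) (hmn : m + 2 ≤ n) {A : Set (SiteConfig (Site 2))} (hA : DeterminedBy A ↑(triBall (n - 1))) :
    (triSitePercolation half).real (flip₁ m n i ⁻¹' A) = (triSitePercolation half).real A := by
  unfold triSitePercolation flip₁
  exact (isStoppingSet_Nfull hm (by omega)).sitePercolation_half_real_preimage_stopFlip (Nfull_subset) hA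

/-- The flip keeps the unflipped sites … [folklore] -/
theorem mem_flip₁_iff_of_mem {ω : SiteConfig (Site 2)} {v : Site 2} (hv : v ∈ Nfull m n i ω) : v ∈ flip₁ m n i ω ↔ v ∈ ω :=
  mem_stopFlip_iff_of_mem hv

/-- … keeps the sites beyond `Λ_{n-1}` … [folklore] -/
theorem mem_flip₁_iff_of_not_mem_ball {ω : SiteConfig (Site 2)} {v : Site 2} (hv : v ∉ triBall (n - 1)) :
    v ∈ flip₁ m n i ω ↔ v ∈ ω :=
  mem_stopFlip_iff_of_not_mem hv

/-- … and changes the flippable unexamined sites. [folklore] -/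
theorem mem_flip₁_iff_of_flip {ω : SiteConfig (Site 2)} {v : Site 2} (hvA : v ∈ Afl m n i) (hv : v ∉ N₁ m n i ω) :
    v ∈ flip₁ m n i ω ↔ v ∉ ω := by
  classical
  refine mem_stopFlip_iff_of_mem_sdiff (Finset.mem_filter.1 hvA).1 fun h => ?_
  unfold Nfull at h
  rcases Finset.mem_union.1 h with h | h
  · exact hv h
  · exact (Finset.mem_sdiff.1 h).2 hvA

/-! ### Plain arms from path data -/

/-- **Plain arms from paths**: pairwise disjoint sets `S_j` carrying lattice paths from `s_j` to sites
of norm `R`, through `s_j` or sites of norm in `(m, R]`, of constant colour `κ_j`, give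
`ω ∈ plainArms κ s m R`. [folklore] -/
theorem mem_plainArms_of_pathIn {k : ℕ} {κ : Fin k → Bool} {s y : Fin k → Site 2} {m R : ℕ} {ω : SiteConfig (Site 2)}
    (S : Fin k → Set (Site 2)) (hS : Pairwise fun a b => Disjoint (S a) (S b)) (hy : ∀ j, triNorm (y j) = R)
    (hp : ∀ j, PathIn triGraph (S j) (s j) (y j))
    (hsub : ∀ j, ∀ v ∈ S j, v = s j ∨ ((m : ℤ) < triNorm v ∧ triNorm v ≤ R))
    (hcol : ∀ j, ∀ v ∈ S j, (v ∈ ω ↔ κ j = true)) : ω ∈ plainArms κ s m R := by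
  classical
  have hW : ∀ j, ∃ W : triGraph.Walk (s j) (y j), W.IsPath ∧ ∀ v ∈ W.support, v ∈ S j := by
    intro j
    obtain ⟨W, hW⟩ := (hp j).exists_walk
    exact ⟨W.toPath, W.toPath.2, fun v hv => hW v (W.support_toPath_subset_support hv)⟩
  choose W hWp hWS using hW
  refine ⟨y, W, fun j => ⟨mem_triSphere_iff.2 (hy j), hWp j, fun v hv => hsub j v (hWS j v hv), fun v hv => hcol j v (hWS j v hv)⟩, ?_⟩
  intro a b hab
  rw [List.disjoint_toFinset_iff_disjoint]
  exact fun v hva hvb => Set.disjoint_left.1 (hS hab) (hWS a v hva) (hWS b v hvb)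

/-! ### The flipped configuration has plain arms `(B,W,B,B,W)` -/

set_option maxHeartbeats 1600000 in
/-- **The flip turns `(B,W,W,W,B)` into `(B,W,B,B,W)` at the radius `n - 1`.** [cite: Nolin2008, §5.1 Prop. 20 (arXiv 0711.4948: Prop. 19)] -/
theorem flip₁_mem (h : GadgetIdx m i) (hmn : m + 2 ≤ n) {ω : SiteConfig (Site 2)}
    (hω : ω ∈ plainArms ![true, false, false, false, true] (sOf m i) m n) (hpaint : ω ∈ paint (coreOf (sOf m i) m) ∅) :
    ∃ k, i 0 < k ∧ k < i 2 ∧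
      flip₁ m n i ω ∈ plainArms ![true, false, true, true, false] (sOf m ![i 0, k, i 2, i 3, i 4]) m (n - 1) := by
  classical
  have hm := h.four_le; have hbase := h.base
  have h01 := h.lt01; have h12 := h.lt12; have h23 := h.lt23; have h34 := h.lt34; have h40 := h.lt40
  have hk : 1 ≤ m := by omega
  have nrp : ∀ j, triNorm (rp m j) = m := fun j => triNorm_rp hk j
  obtain ⟨y, w, hw, hdisj⟩ := hω
  obtain ⟨P1, ⟨q, hqn, hF⟩, ⟨p, hpn, hT⟩, P6, P7, -, -, cX⟩ :=
    walk_package h hmn (κ := ![true, false, false, false, true]) rfl rfl rfl rfl w hw hdisj hpaint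
  set c := col m n i ω with hc
  set X : Set (Site 2) := traversed c (inFace m (i 0)) (len c (inFace m (i 0))) with hX
  set ω' := flip₁ m n i ω with hω'
  -- arms
  have hyn : ∀ j, triNorm (y j) = n := fun j => mem_triSphere_iff.1 (hw j).1
  have hsupp : ∀ j, ∀ v ∈ (w j).support, v = rp m (i j) ∨ ((m : ℤ) < triNorm v ∧ triNorm v ≤ n) := fun j => (hw j).2.2.1
  have hcolw : ∀ j, ∀ v ∈ (w j).support, (v ∈ ω ↔ (![true, false, false, false, true] : Fin 5 → Bool) j = true) :=
    fun j => (hw j).2.2.2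
  have hstart : ∀ j, rp m (i j) ∈ (w j).support := fun j => (w j).start_mem_support
  have hdj : ∀ {a b : Fin 5}, a ≠ b → ∀ v, v ∈ (w a).support → v ∉ (w b).support := fun hab v hv hv' =>
    Finset.disjoint_left.1 (hdisj hab) (List.mem_toFinset.2 hv) (List.mem_toFinset.2 hv')
  have harm : ∀ j, PathIn triGraph {v | v ∈ (w j).support} (rp m (i j)) (y j) := fun j => PathIn.of_walk (w j) fun v hv => hv
  -- colour facts
  have hcoreW : ∀ v, v ∈ coreRing m i → v ∉ ω := by
    rintro v ⟨hv, hvs⟩ hvω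
    have hmem : v ∈ coreOf (sOf m i) m := by
      rw [coreOf, Finset.mem_sdiff, mem_triBall_iff]
      refine ⟨by rw [hv], fun hh => ?_⟩
      obtain ⟨j, -, hj⟩ := Finset.mem_image.1 hh
      exact hvs j hj.symm
    exact (hpaint v hmem).1 hvω
  have cfalse : ∀ {x}, c x = some false → x ∈ ω ∧ x ∉ coreRing m i ∧ (m : ℤ) ≤ triNorm x ∧ triNorm x < n := fun hx => by
    obtain ⟨⟨h1, h2⟩, h3, h4⟩ := col_eq_some_false_iff.1 hx; exact ⟨h4, h3, h1, h2⟩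
  have ctrue : ∀ {x}, c x = some true → x ∉ ω ∧ (m : ℤ) ≤ triNorm x ∧ triNorm x < n := fun hx => by
    obtain ⟨⟨h1, h2⟩, h3⟩ := col_eq_some_true_iff.1 hx
    exact ⟨h3.elim (hcoreW _) id, h1, h2⟩
  -- traversed sites are unflipped
  have hXN : ∀ x ∈ X, x ∈ Nfull m n i ω := by
    intro x hx
    have hnx := (col_eq_none_iff (ω := ω) (m := m) (n := n) (i := i) (v := x)).not.1 (cX x hx)
    push Not at hnx
    unfold Nfull N₁
    by_cases hxA : x ∈ Afl m n i
    · exact Finset.mem_union_left _ (Finset.mem_union_left _ (mem_examined_of_traversed le_rfl hx hxA))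
    · exact Finset.mem_union_right _ (Finset.mem_sdiff.2 ⟨mem_triBall_iff.2 (by omega), hxA⟩)
  have keep : ∀ x ∈ X, (x ∈ ω' ↔ x ∈ ω) := fun x hx => mem_flip₁_iff_of_mem (hXN x hx)
  -- arm sites of `s₂, s₃, s₄` up to the radius `n - 1` are flipped
  have flipArm : ∀ j, j ≠ 0 → j ≠ 1 → ∀ z ∈ (w j).support, triNorm z ≤ ((n - 1 : ℕ) : ℤ) → (z ∈ ω' ↔ z ∉ ω) := by
    intro j hj0 hj1 z hz hzn
    have hib := h.i_bounds j
    have hzA : z ∈ Afl m n i := by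
      rw [mem_Afl]
      rcases hsupp j z hz with rfl | ⟨h1, h2⟩
      · exact ⟨⟨by rw [nrp], hzn⟩, fun ⟨_, hh⟩ => hh j rfl⟩
      · exact ⟨⟨by omega, hzn⟩, fun ⟨hh, _⟩ => by omega⟩
    refine mem_flip₁_iff_of_flip hzA fun hN => ?_
    unfold N₁ at hN
    rcases Finset.mem_union.1 hN with hN | hN
    · exact P1 j hj0 hj1 z hz (traversed_of_mem_examined hN)
    · obtain ⟨hN, -⟩ := Finset.mem_inter.1 hN
      simp only [Finset.mem_insert, Finset.mem_singleton] at hN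
      rcases hN with rfl | hzb
      · exact hdj hj0 _ hz (hstart 0)
      · rcases hsupp j z hz with e | ⟨h1, -⟩
        · rw [hzb] at e
          have : i 0 + 1 = i j := by
            by_contra hne
            rcases lt_or_gt_of_ne hne with hlt | hgt
            · exact rp_ne_rp_of_lt hk hlt (by omega) e
            · exact rp_ne_rp_of_lt hk hgt (by omega) e.symm
          have hj2 : i 2 ≤ i j := by
            fin_cases j <;> simp at hj0 hj1 ⊢ <;> omega
          omega
        · rw [hzb, nrp] at h1; omega
  -- the last ring site of the white chain
  obtain ⟨t, t₁, htC, htS, ht₁C, htt₁, hrest⟩ := hT.last_exit (C := {v | triNorm v ≤ (m : ℤ)}) (by show triNorm (rp m (i 0 + 1)) ≤ (m : ℤ); rw [nrp])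
    (by show ¬ triNorm p ≤ (m : ℤ); omega)
  have htm : triNorm t = m := le_antisymm htC (ctrue htS.1).2.1
  obtain ⟨k, hk1, hk2, rfl⟩ := P7 t htS.2 htS.1 htm
  refine ⟨k, hk1, hk2, ?_⟩
  -- truncated arms of `s₂, s₃, s₄`
  have trunc : ∀ j, ∃ f, triNorm f = (n : ℤ) - 1 ∧
      PathIn triGraph ({v | v ∈ (w j).support} ∩ {v | triNorm v ≤ ((n - 1 : ℕ) : ℤ)}) (rp m (i j)) f := by
    intro j
    obtain ⟨f, hf, pf⟩ := Gadget.exists_pathIn_trunc (R := n - 1) (harm j) (by rw [nrp]; omega) (by rw [hyn]; omega)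
    exact ⟨f, by rw [hf]; omega, pf⟩
  obtain ⟨f2, hf2, pf2⟩ := trunc 2
  obtain ⟨f3, hf3, pf3⟩ := trunc 3
  obtain ⟨f4, hf4, pf4⟩ := trunc 4
  -- the five sets
  let S : Fin 5 → Set (Site 2) := ![{x | c x = some false ∧ x ∈ X},
    {rp m k} ∪ ({x | c x = some true ∧ x ∈ X} \ {v | triNorm v ≤ (m : ℤ)}),
    {v | v ∈ (w 2).support} ∩ {v | triNorm v ≤ ((n - 1 : ℕ) : ℤ)},
    {v | v ∈ (w 3).support} ∩ {v | triNorm v ≤ ((n - 1 : ℕ) : ℤ)},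
    {v | v ∈ (w 4).support} ∩ {v | triNorm v ≤ ((n - 1 : ℕ) : ℤ)}]
  have S1 : S 1 = {rp m k} ∪ ({x | c x = some true ∧ x ∈ X} \ {v | triNorm v ≤ (m : ℤ)}) := rfl
  -- membership of `S 1` sites in `X`
  have S1X : ∀ v ∈ S 1, c v = some true ∧ v ∈ X := by
    rintro v (hv | ⟨hv, -⟩)
    · rw [Set.mem_singleton_iff] at hv; rw [hv]; exact htS
    · exact hv
  have armX : ∀ j, j ≠ 0 → j ≠ 1 → ∀ v ∈ {v | v ∈ (w j).support} ∩ {v | triNorm v ≤ ((n - 1 : ℕ) : ℤ)}, v ∉ X :=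
    fun j hj0 hj1 v hv => P1 j hj0 hj1 v hv.1
  refine mem_plainArms_of_pathIn S ?_ (y := ![q, p, f2, f3, f4]) ?_ ?_ ?_ ?_
  · -- pairwise disjoint
    have d01 : Disjoint (S 0) (S 1) := Set.disjoint_left.2 fun v h0 h1 => by
      change c v = some false ∧ v ∈ X at h0; have := (S1X v h1).1; rw [h0.1] at this; exact absurd this (by simp)
    have d0a : ∀ j, j ≠ 0 → j ≠ 1 → Disjoint (S 0) ({v | v ∈ (w j).support} ∩ {v | triNorm v ≤ ((n - 1 : ℕ) : ℤ)}) :=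
      fun j hj0 hj1 => Set.disjoint_left.2 fun v h0 ha => armX j hj0 hj1 v ha (by change c v = some false ∧ v ∈ X at h0; exact h0.2)
    have d1a : ∀ j, j ≠ 0 → j ≠ 1 → Disjoint (S 1) ({v | v ∈ (w j).support} ∩ {v | triNorm v ≤ ((n - 1 : ℕ) : ℤ)}) :=
      fun j hj0 hj1 => Set.disjoint_left.2 fun v h1 ha => armX j hj0 hj1 v ha (S1X v h1).2
    have daa : ∀ a b : Fin 5, a ≠ b → Disjoint ({v | v ∈ (w a).support} ∩ {v | triNorm v ≤ ((n - 1 : ℕ) : ℤ)})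
        ({v | v ∈ (w b).support} ∩ {v | triNorm v ≤ ((n - 1 : ℕ) : ℤ)}) :=
      fun a b hab => Set.disjoint_left.2 fun v ha hb => hdj hab v ha.1 hb.1
    intro a b hab
    fin_cases a <;> fin_cases b <;> first
      | exact absurd rfl hab
      | exact d01 | exact d01.symm
      | exact d0a _ (by decide) (by decide) | exact (d0a _ (by decide) (by decide)).symm
      | exact d1a _ (by decide) (by decide) | exact (d1a _ (by decide) (by decide)).symm
      | exact daa _ _ (by decide)
  · intro j; fin_cases j
    · show triNorm q = ((n - 1 : ℕ) : ℤ); omega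
    · show triNorm p = ((n - 1 : ℕ) : ℤ); omega
    · show triNorm f2 = ((n - 1 : ℕ) : ℤ); omega
    · show triNorm f3 = ((n - 1 : ℕ) : ℤ); omega
    · show triNorm f4 = ((n - 1 : ℕ) : ℤ); omega
  · intro j; fin_cases j
    · exact hF
    · show PathIn triGraph (S 1) (rp m k) p
      rw [S1]
      exact PathIn.trans (PathIn.of_adj (Or.inl rfl) (Or.inr hrest.left_mem) htt₁) (hrest.mono Set.subset_union_right)
    · exact pf2
    · exact pf3
    · exact pf4
  · intro j v hv
    fin_cases j
    · -- black chain sites: `s₀` or annulus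
      change c v = some false ∧ v ∈ X at hv
      obtain ⟨-, -, h1, h2⟩ := cfalse hv.1
      rcases (lt_or_eq_of_le h1) with hlt | heq
      · right; exact ⟨hlt, by omega⟩
      · left; exact P6 v hv.2 hv.1 heq.symm
    · change v ∈ S 1 at hv
      rcases hv with hv | ⟨hv, hvC⟩
      · left; exact hv
      · right
        obtain ⟨-, h1, h2⟩ := ctrue hv.1
        change ¬ triNorm v ≤ (m : ℤ) at hvC
        exact ⟨by omega, by omega⟩
    · change v ∈ (w 2).support ∧ triNorm v ≤ ((n - 1 : ℕ) : ℤ) at hv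
      rcases hsupp 2 v hv.1 with e | ⟨h1, -⟩
      · left; exact e
      · right; exact ⟨h1, hv.2⟩
    · change v ∈ (w 3).support ∧ triNorm v ≤ ((n - 1 : ℕ) : ℤ) at hv
      rcases hsupp 3 v hv.1 with e | ⟨h1, -⟩
      · left; exact e
      · right; exact ⟨h1, hv.2⟩
    · change v ∈ (w 4).support ∧ triNorm v ≤ ((n - 1 : ℕ) : ℤ) at hv
      rcases hsupp 4 v hv.1 with e | ⟨h1, -⟩
      · left; exact e
      · right; exact ⟨h1, hv.2⟩
  · intro j v hv
    fin_cases j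
    · change c v = some false ∧ v ∈ X at hv
      exact iff_of_true ((keep v hv.2).2 (cfalse hv.1).1) rfl
    · have h1 := S1X v hv
      exact iff_of_false (fun h' => (ctrue h1.1).1 ((keep v h1.2).1 h')) Bool.false_ne_true
    · change v ∈ (w 2).support ∧ triNorm v ≤ ((n - 1 : ℕ) : ℤ) at hv
      have := flipArm 2 (by decide) (by decide) v hv.1 hv.2
      exact iff_of_true (this.2 fun h' => by have := (hcolw 2 v hv.1).1 h'; exact Bool.false_ne_true this) rfl
    · change v ∈ (w 3).support ∧ triNorm v ≤ ((n - 1 : ℕ) : ℤ) at hv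
      have := flipArm 3 (by decide) (by decide) v hv.1 hv.2
      exact iff_of_true (this.2 fun h' => by have := (hcolw 3 v hv.1).1 h'; exact Bool.false_ne_true this) rfl
    · change v ∈ (w 4).support ∧ triNorm v ≤ ((n - 1 : ℕ) : ℤ) at hv
      have := flipArm 4 (by decide) (by decide) v hv.1 hv.2
      exact iff_of_false (fun h' => this.1 h' ((hcolw 4 v hv.1).2 rfl)) Bool.false_ne_true

end InnerFlip

/-! ## Part II — the bound for the arrangement `B W W W B` -/

/-! ### Bookkeeping on plain arms -/

/-- **Re-indexing the arms**: `plainArms κ s ⊆ plainArms (κ ∘ σ) (s ∘ σ)` for a permutation `σ`. [folklore] -/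
theorem plainArms_subset_reindex {k : ℕ} (σ : Fin k ≃ Fin k) (κ : Fin k → Bool) (s : Fin k → Site 2) (m n : ℕ) :
    plainArms κ s m n ⊆ plainArms (κ ∘ σ) (s ∘ σ) m n := by
  rintro ω ⟨y, w, hw, hd⟩
  exact ⟨y ∘ σ, fun j => w (σ j), fun j => hw (σ j), fun a b hab => hd (σ.injective.ne hab)⟩

/-- **Flipping all colours**: `ω ∈ plainArms κ s` iff `ωᶜ ∈ plainArms (¬κ) s` (one direction). [folklore] -/
theorem compl_mem_plainArms {k : ℕ} {κ : Fin k → Bool} {s : Fin k → Site 2} {m n : ℕ} {ω : SiteConfig (Site 2)}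
    (hω : ω ∈ plainArms κ s m n) : ωᶜ ∈ plainArms (fun j => !κ j) s m n := by
  obtain ⟨y, w, hw, hd⟩ := hω
  refine ⟨y, w, fun j => ⟨(hw j).1, (hw j).2.1, (hw j).2.2.1, fun v hv => ?_⟩, hd⟩
  show v ∈ ωᶜ ↔ (!κ j) = true
  rw [Set.mem_compl_iff, (hw j).2.2.2 v hv]
  cases κ j <;> simp

/-- The probability of plain arms is at most that of the colour-flipped plain arms. [folklore] -/
theorem real_plainArms_le_not {k : ℕ} (κ : Fin k → Bool) (s : Fin k → Site 2) (m n : ℕ) :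
    (triSitePercolation half).real (plainArms κ s m n) ≤ (triSitePercolation half).real (plainArms (fun j => !κ j) s m n) := by
  calc (triSitePercolation half).real (plainArms κ s m n)
      ≤ (triSitePercolation half).real (compl ⁻¹' plainArms (fun j => !κ j) s m n) :=
        measureReal_mono fun ω hω => compl_mem_plainArms hω
    _ = (triSitePercolation half).real (plainArms (fun j => !κ j) s m n) := by
        unfold triSitePercolation
        rw [sitePercolation_real_preimage_compl, symm_half]

/-- A finite union of events determined by `F` is determined by `F`. [folklore] -/
theorem determinedBy_biUnion_finset {ι α : Type*} {t : Finset α} {A : α → Set (Set ι)} {F : Set ι}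
    (h : ∀ a ∈ t, DeterminedBy (A a) F) : DeterminedBy (⋃ a ∈ t, A a) F := by
  rw [determinedBy_iff]
  intro ω ω' hF
  simp only [Set.mem_iUnion, exists_prop]
  exact exists_congr fun a => and_congr_right fun ha => (determinedBy_iff _ _).1 (h a ha) ω ω' hF

/-- The plain-arm event at radius `n` is determined by `Λ_n` (landing sites of norm `≤ n`). [folklore] -/
theorem determinedBy_plainArms_ball {k : ℕ} (κ : Fin k → Bool) {s : Fin k → Site 2} {m n : ℕ}
    (hs : ∀ j, triNorm (s j) ≤ n) : DeterminedBy (plainArms κ s m n) ↑(triBall n) := by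
  refine (determinedBy_plainArms κ s m n).mono fun v hv => ?_
  rw [Finset.mem_coe, plainSites, Finset.mem_union, Finset.mem_image, Finset.mem_sdiff] at hv
  rw [Finset.mem_coe, mem_triBall_iff]
  rcases hv with ⟨j, -, rfl⟩ | ⟨h, -⟩
  · exact hs j
  · exact mem_triBall_iff.1 h

/-! ### The bound -/

/-- **The five-arm upper bound for plain arms in the arrangement `B W W W B`.** For every core radius
`m ≥ 4` there is `C` such that for all landing indices `i` with `GadgetIdx m i` and all `n ≥ m`,
`P_{1/2}(plainArms (B,W,W,W,B) (rp m ∘ i) m n) ≤ C / n²`. [cite: Nolin2008, §5.1 Prop. 20 with §5.2 Thm. 24, five-arm item (arXiv 0711.4948: Prop. 19, Thm. 23 (iii))] -/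
theorem real_plainArms_BB_le {m : ℕ} (hm : 4 ≤ m) :
    ∃ C : ℝ, ∀ i : Fin 5 → ℕ, GadgetIdx m i → ∀ n : ℕ, m ≤ n →
      (triSitePercolation half).real (plainArms ![true, false, false, false, true] (sOf m i) m n) ≤ C / (n : ℝ) ^ 2 := by
  classical
  obtain ⟨C₀, hC₀⟩ := exists_real_plainArms_E_le hm
  set CE := max C₀ 0 with hCE
  have hCE0 : 0 ≤ CE := le_max_right _ _
  have hE : ∀ i : Fin 5 → ℕ, GadgetIdx m i → ∀ n : ℕ, m ≤ n →
      (triSitePercolation half).real (plainArms κE (sOf m i) m n) ≤ CE / (n : ℝ) ^ 2 := fun i hi n hn =>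
    (hC₀ i hi n hn).trans (div_le_div_of_nonneg_right (le_max_left _ _) (by positivity))
  set K : ℝ := 2 ^ (triBall m).card * (6 * m) * (4 * CE) with hK
  have hK0 : 0 ≤ K := by positivity
  refine ⟨K + ((m : ℝ) + 2) ^ 2, fun i hi n hmn => ?_⟩
  set μ := triSitePercolation half with hμ
  have hm4 := hi.four_le; have hbase := hi.base
  have h01 := hi.lt01; have h12 := hi.lt12; have h23 := hi.lt23; have h34 := hi.lt34; have h40 := hi.lt40
  have hk : 1 ≤ m := by omega
  have hn : (0 : ℝ) < n := by exact_mod_cast (show 0 < n by omega)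
  have hn2 : (0 : ℝ) < (n : ℝ) ^ 2 := by positivity
  by_cases hsmall : n < m + 2
  · calc μ.real (plainArms ![true, false, false, false, true] (sOf m i) m n) ≤ 1 := measureReal_le_one
      _ ≤ ((m : ℝ) + 2) ^ 2 / (n : ℝ) ^ 2 := by
          rw [le_div_iff₀ hn2, one_mul]
          have : (n : ℝ) ≤ m + 2 := by exact_mod_cast (by omega : n ≤ m + 2)
          exact pow_le_pow_left₀ hn.le this 2
      _ ≤ (K + ((m : ℝ) + 2) ^ 2) / (n : ℝ) ^ 2 := div_le_div_of_nonneg_right (by linarith) hn2.le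
  push Not at hsmall
  -- the index family of the image events
  set I : ℕ → Fin 5 → ℕ := fun k => ![i 0, k, i 2, i 3, i 4] with hI
  set B : Set (SiteConfig (Site 2)) :=
    ⋃ k ∈ Finset.Ioo (i 0) (i 2), plainArms ![true, false, true, true, false] (sOf m (I k)) m (n - 1) with hB
  -- finite energy
  set Src := plainArms ![true, false, false, false, true] (sOf m i) m n ∩ paint (coreOf (sOf m i) m) ∅ with hSrc
  have hfe : μ.real (plainArms ![true, false, false, false, true] (sOf m i) m n) ≤ 2 ^ (triBall m).card * μ.real Src := by
    rw [hμ, real_plainArms_eq_mul_paint _ (sOf m i) m n ∅]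
    refine mul_le_mul_of_nonneg_right ?_ measureReal_nonneg
    exact pow_le_pow_right₀ (by norm_num) (card_coreOf_le _ _)
  -- the flip
  have hSrcB : Src ⊆ InnerFlip.flip₁ m n i ⁻¹' B := by
    rintro ω ⟨hω, hpaint⟩
    obtain ⟨k, hk1, hk2, hmem⟩ := InnerFlip.flip₁_mem hi hsmall hω hpaint
    show InnerFlip.flip₁ m n i ω ∈ B
    rw [hB]
    simp only [Set.mem_iUnion, Finset.mem_Ioo, exists_prop]
    exact ⟨k, ⟨hk1, hk2⟩, hmem⟩
  have hBdet : DeterminedBy B ↑(triBall (n - 1)) := by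
    refine determinedBy_biUnion_finset fun k _ => determinedBy_plainArms_ball _ fun j => ?_
    show triNorm (rp m (I k j)) ≤ ((n - 1 : ℕ) : ℤ)
    rw [triNorm_rp hk]; omega
  have hflip : μ.real Src ≤ μ.real B :=
    (measureReal_mono hSrcB).trans (le_of_eq (InnerFlip.real_preimage_flip₁ (by omega) hsmall hBdet))
  -- union bound and the `B W B W W` bound for each term
  have hn1 : m ≤ n - 1 := by omega
  have hterm : ∀ k ∈ Finset.Ioo (i 0) (i 2),
      μ.real (plainArms ![true, false, true, true, false] (sOf m (I k)) m (n - 1)) ≤ CE / ((n - 1 : ℕ) : ℝ) ^ 2 := by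
    intro k hk'
    rw [Finset.mem_Ioo] at hk'
    -- flip all colours, then read the tuple from its last landing
    set J : Fin 5 → ℕ := ![i 4, i 0 + 6 * m, k + 6 * m, i 2 + 6 * m, i 3 + 6 * m] with hJ
    have hJidx : GadgetIdx m J :=
      { four_le := hm4, base := by show 6 * m ≤ i 4; omega, lt01 := by show i 4 < i 0 + 6 * m; omega,
        lt12 := by show i 0 + 6 * m < k + 6 * m; omega, lt23 := by show k + 6 * m < i 2 + 6 * m; omega,
        lt34 := by show i 2 + 6 * m < i 3 + 6 * m; omega, lt40 := by show i 3 + 6 * m < i 4 + 6 * m; omega }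
    -- the rotation `σ = (0 1 2 3 4) ↦ (4 0 1 2 3)` as an equivalence
    let σ : Fin 5 ≃ Fin 5 := finRotate 5 |>.symm
    have hσ : ∀ j : Fin 5, σ j = j - 1 := fun j => by fin_cases j <;> rfl
    have hκ : (fun j => !(![true, false, true, true, false] : Fin 5 → Bool) j) ∘ σ = κE := by
      funext j; fin_cases j <;> rfl
    have hs : sOf m (I k) ∘ σ = sOf m J := by
      funext j
      fin_cases j
      · rfl
      · show rp m (i 0) = rp m (i 0 + 6 * m); rw [rp_add_period]
      · show rp m k = rp m (k + 6 * m); rw [rp_add_period]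
      · show rp m (i 2) = rp m (i 2 + 6 * m); rw [rp_add_period]
      · show rp m (i 3) = rp m (i 3 + 6 * m); rw [rp_add_period]
    calc μ.real (plainArms ![true, false, true, true, false] (sOf m (I k)) m (n - 1))
        ≤ μ.real (plainArms (fun j => !(![true, false, true, true, false] : Fin 5 → Bool) j) (sOf m (I k)) m (n - 1)) :=
          real_plainArms_le_not _ _ _ _
      _ ≤ μ.real (plainArms κE (sOf m J) m (n - 1)) := by
          rw [← hκ, ← hs]; exact measureReal_mono (plainArms_subset_reindex σ _ _ _ _)
      _ ≤ CE / ((n - 1 : ℕ) : ℝ) ^ 2 := hE J hJidx (n - 1) hn1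
  have hcard : ((Finset.Ioo (i 0) (i 2)).card : ℝ) ≤ 6 * m := by
    rw [Nat.card_Ioo]; exact_mod_cast (by omega : i 2 - i 0 - 1 ≤ 6 * m)
  have hn1R : ((n : ℝ) ^ 2) ≤ 4 * ((n - 1 : ℕ) : ℝ) ^ 2 := by
    have h1 : ((n - 1 : ℕ) : ℝ) = n - 1 := by push_cast [Nat.cast_sub (show 1 ≤ n by omega)]; ring
    rw [h1]
    have : (2 : ℝ) ≤ n := by exact_mod_cast (show 2 ≤ n by omega)
    nlinarith
  have hn1pos : (0 : ℝ) < ((n - 1 : ℕ) : ℝ) ^ 2 := by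
    have : (1 : ℝ) ≤ ((n - 1 : ℕ) : ℝ) := by exact_mod_cast (show 1 ≤ n - 1 by omega)
    positivity
  have hBle : μ.real B ≤ 6 * m * (CE / ((n - 1 : ℕ) : ℝ) ^ 2) := by
    calc μ.real B ≤ ∑ k ∈ Finset.Ioo (i 0) (i 2), μ.real (plainArms ![true, false, true, true, false] (sOf m (I k)) m (n - 1)) :=
          measureReal_biUnion_finset_le _ _
      _ ≤ ∑ k ∈ Finset.Ioo (i 0) (i 2), CE / ((n - 1 : ℕ) : ℝ) ^ 2 := Finset.sum_le_sum hterm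
      _ = (Finset.Ioo (i 0) (i 2)).card * (CE / ((n - 1 : ℕ) : ℝ) ^ 2) := by rw [Finset.sum_const, nsmul_eq_mul]
      _ ≤ 6 * m * (CE / ((n - 1 : ℕ) : ℝ) ^ 2) := mul_le_mul_of_nonneg_right hcard (by positivity)
  have hinv : CE / ((n - 1 : ℕ) : ℝ) ^ 2 ≤ 4 * CE / (n : ℝ) ^ 2 := by
    rw [div_le_div_iff₀ hn1pos hn2]
    nlinarith
  calc μ.real (plainArms ![true, false, false, false, true] (sOf m i) m n)
      ≤ 2 ^ (triBall m).card * μ.real Src := hfe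
    _ ≤ 2 ^ (triBall m).card * (6 * m * (4 * CE / (n : ℝ) ^ 2)) := by
        refine mul_le_mul_of_nonneg_left (hflip.trans (hBle.trans ?_)) (by positivity)
        exact mul_le_mul_of_nonneg_left hinv (by positivity)
    _ = K / (n : ℝ) ^ 2 := by rw [hK]; ring
    _ ≤ (K + ((m : ℝ) + 2) ^ 2) / (n : ℝ) ^ 2 := div_le_div_of_nonneg_right (le_add_of_nonneg_right (by positivity)) hn2.le

/-! ## Part III — the transposition on the rings and on plain arms -/

/-! ### Norm and rings under the transposition -/

set_option maxHeartbeats 4000000 in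
/-- **The transposition reverses the rings**: `ringPt k i ↦ rp k (9k - i)` (`i < 6k`). [folklore] -/
theorem transposeIso_ringPt {k i : ℕ} (hk : 1 ≤ k) (hi : i < 6 * k) : transposeIso (ringPt k i) = rp k (9 * k - i) := by
  have h0 := transposeIso_apply_zero (ringPt k i)
  have h1 := transposeIso_apply_one (ringPt k i)
  by_cases hle : i ≤ 3 * k
  · have e : rp k (9 * k - i) = ringPt k (3 * k - i) := by
      rw [show 9 * k - i = (3 * k - i) + 6 * k by omega, rp_add_period, rp_of_lt (by omega)]
    rw [e]
    apply eq_ringPt_of_apply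
    · rw [h0]
      rcases ringPt_spec k i with h | h | h | h | h | h <;> rcases ringPt_spec k (3 * k - i) with h' | h' | h' | h' | h' | h' <;> omega
    · rw [h1]
      rcases ringPt_spec k i with h | h | h | h | h | h <;> rcases ringPt_spec k (3 * k - i) with h' | h' | h' | h' | h' | h' <;> omega
  · have e : rp k (9 * k - i) = ringPt k (9 * k - i) := rp_of_lt (by omega)
    rw [e]
    apply eq_ringPt_of_apply
    · rw [h0]
      rcases ringPt_spec k i with h | h | h | h | h | h <;> rcases ringPt_spec k (9 * k - i) with h' | h' | h' | h' | h' | h' <;> omega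
    · rw [h1]
      rcases ringPt_spec k i with h | h | h | h | h | h <;> rcases ringPt_spec k (9 * k - i) with h' | h' | h' | h' | h' | h' <;> omega

/-- **The transposition on the periodic enumeration**: `rp k i ↦ rp k (c - i)` for every
`c ≡ 9k (mod 6k)` with `c > i + 3k`. [folklore] -/
theorem transposeIso_rp {k i c : ℕ} (hk : 1 ≤ k) (hc : ∃ q, c = 9 * k + q * (6 * k)) (hci : i + 3 * k < c) :
    transposeIso (rp k i) = rp k (c - i) := by
  obtain ⟨q, rfl⟩ := hc
  have hP : 0 < 6 * k := by omega
  obtain ⟨d, hd⟩ : ∃ d, d * (6 * k) + i % (6 * k) = i := ⟨i / (6 * k), by rw [mul_comm]; exact Nat.div_add_mod i (6 * k)⟩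
  have hlt : i % (6 * k) < 6 * k := Nat.mod_lt _ hP
  have hrp : rp k i = ringPt k (i % (6 * k)) := rfl
  rw [hrp, transposeIso_ringPt hk hlt]
  -- `9k + 6kq - i = (9k - i % 6k) + (q - d) 6k`
  have hdq : d ≤ q := by
    by_contra hlt'
    have : (q + 1) * (6 * k) ≤ d * (6 * k) := Nat.mul_le_mul_right _ (by omega)
    have e : (q + 1) * (6 * k) = q * (6 * k) + 6 * k := by ring
    omega
  obtain ⟨r, rfl⟩ : ∃ r, q = d + r := ⟨q - d, by omega⟩
  have e : 9 * k + (d + r) * (6 * k) - i = (9 * k - i % (6 * k)) + r * (6 * k) := by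
    have e1 : (d + r) * (6 * k) = d * (6 * k) + r * (6 * k) := by ring
    omega
  rw [e, rp_add_mul_period]

/-! ### The mirrored landing indices -/

/-- The period offset of the mirror: `c = 9m + (i₀ / 6m + 2) · 6m`. [folklore] -/
def mirrorC (m : ℕ) (i : Fin 5 → ℕ) : ℕ := 9 * m + (i 0 / (6 * m) + 2) * (6 * m)

/-- **The mirrored landing indices**, anticlockwise from the transposed black landing:
`(c - i₀, c + 6m - i₄, c + 6m - i₃, c + 6m - i₂, c + 6m - i₁)`. [folklore] -/
def mirrorIdx (m : ℕ) (i : Fin 5 → ℕ) : Fin 5 → ℕ :=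
  ![mirrorC m i - i 0, mirrorC m i + 6 * m - i 4, mirrorC m i + 6 * m - i 3, mirrorC m i + 6 * m - i 2, mirrorC m i + 6 * m - i 1]

/-- The offset dominates all landing indices by `3m`. [folklore] -/
theorem mirrorC_ge {m : ℕ} {i : Fin 5 → ℕ} (h : GadgetIdx m i) (j : Fin 5) :
    i j + 3 * m < mirrorC m i ∧ i 0 + 6 * m + 3 * m < mirrorC m i := by
  have hm := h.four_le
  have hP : 0 < 6 * m := by omega
  have hib := h.i_bounds j
  have hdm := Nat.div_add_mod (i 0) (6 * m)
  have hml := Nat.mod_lt (i 0) hP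
  have e : mirrorC m i = 9 * m + (6 * m * (i 0 / (6 * m)) + 12 * m) := by unfold mirrorC; ring
  generalize 6 * m * (i 0 / (6 * m)) = D at hdm e
  omega

/-- **The mirrored indices are landing indices.** [folklore] -/
theorem gadgetIdx_mirrorIdx {m : ℕ} {i : Fin 5 → ℕ} (h : GadgetIdx m i) : GadgetIdx m (mirrorIdx m i) := by
  have hm := h.four_le; have h01 := h.lt01; have h12 := h.lt12; have h23 := h.lt23; have h34 := h.lt34; have h40 := h.lt40
  have hc := fun j => (mirrorC_ge h j).1
  have hc0 := (mirrorC_ge h 0).2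
  have := hc 0; have := hc 1; have := hc 2; have := hc 3; have := hc 4
  exact { four_le := hm, base := by show 6 * m ≤ mirrorC m i - i 0; omega,
          lt01 := by show mirrorC m i - i 0 < mirrorC m i + 6 * m - i 4; omega,
          lt12 := by show mirrorC m i + 6 * m - i 4 < mirrorC m i + 6 * m - i 3; omega,
          lt23 := by show mirrorC m i + 6 * m - i 3 < mirrorC m i + 6 * m - i 2; omega,
          lt34 := by show mirrorC m i + 6 * m - i 2 < mirrorC m i + 6 * m - i 1; omega,
          lt40 := by show mirrorC m i + 6 * m - i 1 < mirrorC m i - i 0 + 6 * m; omega }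

/-- The reversal of the order of the four other landings. [folklore] -/
def mirrorPerm : Fin 5 → Fin 5 := ![0, 4, 3, 2, 1]

/-- **The transposed landing sites are the mirrored landing sites** (in the order `0, 4, 3, 2, 1`). [folklore] -/
theorem transposeIso_sOf {m : ℕ} {i : Fin 5 → ℕ} (h : GadgetIdx m i) (j : Fin 5) :
    transposeIso (sOf m i (mirrorPerm j)) = sOf m (mirrorIdx m i) j := by
  have hm := h.four_le
  have hk : 1 ≤ m := by omega
  have hq : ∃ q, mirrorC m i = 9 * m + q * (6 * m) := ⟨_, rfl⟩
  have hq' : ∃ q, mirrorC m i + 6 * m = 9 * m + q * (6 * m) := ⟨i 0 / (6 * m) + 3, by unfold mirrorC; ring⟩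
  have hc := fun j => (mirrorC_ge h j).1
  have := hc 0; have := hc 1; have := hc 2; have := hc 3; have := hc 4
  fin_cases j
  · show transposeIso (rp m (i 0)) = rp m (mirrorC m i - i 0)
    exact transposeIso_rp hk hq (by omega)
  · show transposeIso (rp m (i 4)) = rp m (mirrorC m i + 6 * m - i 4)
    exact transposeIso_rp hk hq' (by omega)
  · show transposeIso (rp m (i 3)) = rp m (mirrorC m i + 6 * m - i 3)
    exact transposeIso_rp hk hq' (by omega)
  · show transposeIso (rp m (i 2)) = rp m (mirrorC m i + 6 * m - i 2)
    exact transposeIso_rp hk hq' (by omega)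
  · show transposeIso (rp m (i 1)) = rp m (mirrorC m i + 6 * m - i 1)
    exact transposeIso_rp hk hq' (by omega)

/-- **The transposition of `s₀⁻` is the site after the mirrored `s₀`.** [folklore] -/
theorem transposeIso_pred {m : ℕ} {i : Fin 5 → ℕ} (h : GadgetIdx m i) :
    transposeIso (rp m (i 0 - 1)) = rp m (mirrorIdx m i 0 + 1) := by
  have hm := h.four_le; have hbase := h.base
  have hk : 1 ≤ m := by omega
  have := (mirrorC_ge h 0).2
  rw [transposeIso_rp hk ⟨_, rfl⟩ (by omega : i 0 - 1 + 3 * m < mirrorC m i)]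
  show rp m (mirrorC m i - (i 0 - 1)) = rp m (mirrorC m i - i 0 + 1)
  congr 1; omega

/-- … and conversely `s₀⁺` transposes to the site before the mirrored `s₀`. [folklore] -/
theorem transposeIso_succ {m : ℕ} {i : Fin 5 → ℕ} (h : GadgetIdx m i) :
    transposeIso (rp m (i 0 + 1)) = rp m (mirrorIdx m i 0 - 1) := by
  have hm := h.four_le; have hbase := h.base
  have hk : 1 ≤ m := by omega
  have := (mirrorC_ge h 0).2
  rw [transposeIso_rp hk ⟨_, rfl⟩ (by omega : i 0 + 1 + 3 * m < mirrorC m i)]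
  rfl

/-- **Ring indices under the mirror**: a ring site `rp m k'` with `mirrorIdx 0 < k' < mirrorIdx 2`
is the transposition of a ring site `rp m k` with `i₃ < k < i₀ + 6m`. [folklore] -/
theorem exists_idx_of_mirror {m : ℕ} {i : Fin 5 → ℕ} (h : GadgetIdx m i) {k' : ℕ} (h1 : mirrorIdx m i 0 < k')
    (h2 : k' < mirrorIdx m i 2) : ∃ k, i 3 < k ∧ k < i 0 + 6 * m ∧ transposeIso (rp m k) = rp m k' := by
  have hm := h.four_le; have hbase := h.base; have h34 := h.lt34; have h40 := h.lt40
  have hk : 1 ≤ m := by omega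
  have hc := fun j => (mirrorC_ge h j).1
  have := hc 0; have := hc 3; have := hc 4
  change mirrorC m i - i 0 < k' at h1
  change k' < mirrorC m i + 6 * m - i 3 at h2
  refine ⟨mirrorC m i + 6 * m - k', by omega, by omega, ?_⟩
  rw [transposeIso_rp hk ⟨i 0 / (6 * m) + 3, by unfold mirrorC; ring⟩ (by omega : mirrorC m i + 6 * m - k' + 3 * m < mirrorC m i + 6 * m)]
  congr 1; omega

/-! ### Transport of events -/

/-- The transposed configuration. [folklore] -/
def transposeCfg (ω : SiteConfig (Site 2)) : SiteConfig (Site 2) := {v | transposeIso v ∈ ω}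

/-- Membership in the transposed configuration. [folklore] -/
@[simp] theorem mem_transposeCfg {ω : SiteConfig (Site 2)} {v : Site 2} : v ∈ transposeCfg ω ↔ transposeIso v ∈ ω := Iff.rfl

/-- The transposed configuration is the image under the transposition. [folklore] -/
theorem transposeCfg_eq_image (ω : SiteConfig (Site 2)) : transposeCfg ω = transposeIso '' ω := by
  ext v
  rw [mem_transposeCfg, Set.mem_image]
  constructor
  · exact fun h => ⟨_, h, transposeIso_transposeIso v⟩
  · rintro ⟨u, hu, rfl⟩; rw [transposeIso_transposeIso]; exact hu

/-- The transposition is an involution on configurations. [folklore] -/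
theorem transposeCfg_transposeCfg (ω : SiteConfig (Site 2)) : transposeCfg (transposeCfg ω) = ω := by
  ext v; rw [mem_transposeCfg, mem_transposeCfg, transposeIso_transposeIso]

/-- **Plain arms are transported by the transposition** (with any re-indexing of the arms). [folklore] -/
theorem transpose_mem_plainArms {k : ℕ} {κ : Fin k → Bool} {s : Fin k → Site 2} {m n : ℕ} {ω : SiteConfig (Site 2)}
    (hω : ω ∈ plainArms κ s m n) : transposeCfg ω ∈ plainArms κ (fun j => transposeIso (s j)) m n := by
  classical
  obtain ⟨y, w, hw, hd⟩ := hω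
  have hdj : ∀ {a b : Fin k}, a ≠ b → ∀ v, v ∈ (w a).support → v ∉ (w b).support := fun hab v hv hv' =>
    Finset.disjoint_left.1 (hd hab) (List.mem_toFinset.2 hv) (List.mem_toFinset.2 hv')
  refine InnerFlip.mem_plainArms_of_pathIn (fun j => transposeIso '' {v | v ∈ (w j).support}) ?_ (y := fun j => transposeIso (y j)) ?_ ?_ ?_ ?_
  · intro a b hab
    refine Set.disjoint_left.2 ?_
    rintro _ ⟨u, hu, rfl⟩ ⟨u', hu', he⟩
    rw [transposeIso.injective he] at hu'
    exact hdj hab u hu hu'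
  · intro j; rw [triNorm_transposeIso]; exact mem_triSphere_iff.1 (hw j).1
  · intro j; exact pathIn_map_iso triSwapIso (PathIn.of_walk (w j) fun v hv => hv)
  · rintro j _ ⟨u, hu, rfl⟩
    rcases (hw j).2.2.1 u hu with rfl | h
    · exact Or.inl rfl
    · right; rw [triNorm_transposeIso]; exact h
  · rintro j _ ⟨u, hu, rfl⟩
    rw [mem_transposeCfg, transposeIso_transposeIso]
    exact (hw j).2.2.2 u hu

/-- **The white core is transported by the transposition.** [folklore] -/
theorem transpose_mem_paint {k : ℕ} {s : Fin k → Site 2} {m : ℕ} {ω : SiteConfig (Site 2)}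
    (hω : ω ∈ paint (coreOf s m) ∅) : transposeCfg ω ∈ paint (coreOf (fun j => transposeIso (s j)) m) ∅ := by
  classical
  intro v hv
  rw [coreOf, Finset.mem_sdiff, mem_triBall_iff] at hv
  have hv' : transposeIso v ∈ coreOf s m := by
    rw [coreOf, Finset.mem_sdiff, mem_triBall_iff, triNorm_transposeIso]
    refine ⟨hv.1, fun hh => hv.2 ?_⟩
    obtain ⟨j, -, hj⟩ := Finset.mem_image.1 hh
    refine Finset.mem_image.2 ⟨j, Finset.mem_univ _, ?_⟩
    rw [hj, transposeIso_transposeIso]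
  rw [mem_transposeCfg]
  exact hω _ hv'

/-- The mirrored source event: plain arms `(B,W,W,W,W)` with white core transpose to plain arms
`(B,W,W,W,W)` from the mirrored tuple with white core. [folklore] -/
theorem transpose_mem_src {m n : ℕ} {i : Fin 5 → ℕ} (h : GadgetIdx m i) {ω : SiteConfig (Site 2)}
    (hω : ω ∈ plainArms ![true, false, false, false, false] (sOf m i) m n) (hpaint : ω ∈ paint (coreOf (sOf m i) m) ∅) :
    transposeCfg ω ∈ plainArms ![true, false, false, false, false] (sOf m (mirrorIdx m i)) m n ∧
      transposeCfg ω ∈ paint (coreOf (sOf m (mirrorIdx m i)) m) ∅ := by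
  classical
  -- re-index the arms by the reversal, then transpose
  let σ : Fin 5 ≃ Fin 5 := ⟨mirrorPerm, mirrorPerm, fun j => by fin_cases j <;> rfl, fun j => by fin_cases j <;> rfl⟩
  have hκ : (![true, false, false, false, false] : Fin 5 → Bool) ∘ σ = ![true, false, false, false, false] := by
    funext j; fin_cases j <;> rfl
  have h1 := plainArms_subset_reindex σ _ _ m n hω
  rw [hκ] at h1
  have h2 := transpose_mem_plainArms h1
  have hs : (fun j => transposeIso ((sOf m i ∘ σ) j)) = sOf m (mirrorIdx m i) := funext fun j => transposeIso_sOf h j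
  rw [hs] at h2
  refine ⟨h2, ?_⟩
  have h3 := transpose_mem_paint (s := sOf m i ∘ σ) (m := m) (ω := ω) ?_
  · rw [hs] at h3; exact h3
  · -- the core does not depend on the order of the landing sites
    have himg : (Finset.univ.image (sOf m i ∘ σ) : Finset (Site 2)) = Finset.univ.image (sOf m i) := by
      ext v
      simp only [Finset.mem_image, Finset.mem_univ, true_and, Function.comp]
      exact ⟨fun ⟨j, hj⟩ => ⟨σ j, hj⟩, fun ⟨j, hj⟩ => ⟨σ.symm j, by rw [σ.apply_symm_apply]; exact hj⟩⟩
    have : coreOf (sOf m i ∘ σ) m = coreOf (sOf m i) m := by rw [coreOf, coreOf, himg]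
    rw [this]; exact hpaint

/-! ## Part IV — the double flip `(B,W,W,W,W) → (B,W,B,B,W)` -/

open InnerFlip

namespace InnerFlip2

variable (m n : ℕ) (i : Fin 5 → ℕ)

open Classical in
/-- **The examined set of the second walk**: the transposed examined set of the first walk of the
transposed configuration from the mirrored tuple. [cite: Nolin2008, §5.1 Prop. 20 (arXiv 0711.4948: Prop. 19)] -/
def N₂ (ω : SiteConfig (Site 2)) : Finset (Site 2) := (N₁ m n (mirrorIdx m i) (transposeCfg ω)).image transposeIso

/-- **The unflipped set**: both examined sets and the non-flippable sites of `Λ_{n-1}`. [folklore] -/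
def Nboth (ω : SiteConfig (Site 2)) : Finset (Site 2) := (N₁ m n i ω ∪ N₂ m n i ω) ∪ (triBall (n - 1) \ Afl m n i)

/-- **The double flip.** [cite: Nolin2008, §5.1 Prop. 20 (arXiv 0711.4948: Prop. 19)] -/
def flip₂ : SiteConfig (Site 2) → SiteConfig (Site 2) := stopFlip (triBall (n - 1)) (Nboth m n i)

variable {m n i}

/-- The second examined set is a stopping set. [folklore] -/
theorem isStoppingSet_N₂ (hm : 2 ≤ m) (hn : 1 ≤ n) : IsStoppingSet (N₂ m n i) := by
  classical
  intro ω ω' hag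
  unfold N₂
  rw [isStoppingSet_N₁ hm hn (transposeCfg ω) (transposeCfg ω') fun v hv => ?_]
  have := hag (transposeIso v) (Finset.mem_image_of_mem _ hv)
  simpa using this

/-- The unflipped set is a stopping set … [folklore] -/
theorem isStoppingSet_Nboth (hm : 2 ≤ m) (hn : 1 ≤ n) : IsStoppingSet (Nboth m n i) := by
  intro ω ω' hag
  unfold Nboth
  rw [isStoppingSet_N₁ hm hn ω ω' fun v hv => hag v (Finset.mem_union_left _ (Finset.mem_union_left _ hv)),
    isStoppingSet_N₂ hm hn ω ω' fun v hv => hag v (Finset.mem_union_left _ (Finset.mem_union_right _ hv))]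

/-- The flippable sets correspond under the transposition. [folklore] -/
theorem mem_Afl_mirror {m n : ℕ} {i : Fin 5 → ℕ} (h : GadgetIdx m i) {v : Site 2} :
    v ∈ Afl m n (mirrorIdx m i) ↔ transposeIso v ∈ Afl m n i := by
  rw [mem_Afl, mem_Afl, triNorm_transposeIso]
  have hcore : v ∈ coreRing m (mirrorIdx m i) ↔ transposeIso v ∈ coreRing m i := by
    simp only [coreRing, Set.mem_setOf_eq, triNorm_transposeIso]
    refine and_congr_right fun _ => ⟨fun hh j e => ?_, fun hh j e => ?_⟩
    · -- `transposeIso v = s_j` means `v = transposeIso s_j`, a mirrored landing site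
      obtain ⟨j', hj'⟩ : ∃ j', mirrorPerm j' = j := by fin_cases j <;> [exact ⟨0, rfl⟩; exact ⟨4, rfl⟩; exact ⟨3, rfl⟩; exact ⟨2, rfl⟩; exact ⟨1, rfl⟩]
      refine hh j' ?_
      rw [← transposeIso_sOf h j', hj', ← e, transposeIso_transposeIso]
    · refine hh (mirrorPerm j) ?_
      rw [← transposeIso_transposeIso (sOf m i (mirrorPerm j)), transposeIso_sOf h j, e]
  rw [hcore]

/-- … contained in `Λ_{n-1}`. [folklore] -/
theorem Nboth_subset (ω : SiteConfig (Site 2)) : Nboth m n i ω ⊆ triBall (n - 1) := by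
  classical
  intro v hv
  unfold Nboth N₂ at hv
  simp only [Finset.mem_union, Finset.mem_sdiff, Finset.mem_image] at hv
  rcases hv with (hv | ⟨u, hu, rfl⟩) | ⟨hv, -⟩
  · exact Nfull_subset ω (by unfold Nfull; exact Finset.mem_union_left _ hv)
  · have := Nfull_subset (i := mirrorIdx m i) (transposeCfg ω) (by unfold Nfull; exact Finset.mem_union_left _ hu)
    rw [mem_triBall_iff] at this ⊢
    rw [triNorm_transposeIso]; exact this
  · exact hv

/-- **The double flip preserves `P_{1/2}`** on events determined by `Λ_{n-1}`. [cite: BollobasRiordan2006, Ch. 7 proof of Lemma 6 p. 175] -/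
theorem real_preimage_flip₂ (h : GadgetIdx m i) (hmn : m + 2 ≤ n) {A : Set (SiteConfig (Site 2))} (hA : DeterminedBy A ↑(triBall (n - 1))) :
    (triSitePercolation half).real (flip₂ m n i ⁻¹' A) = (triSitePercolation half).real A := by
  unfold triSitePercolation flip₂
  exact (isStoppingSet_Nboth (by have := h.four_le; omega) (by omega)).sitePercolation_half_real_preimage_stopFlip Nboth_subset hA

/-! ### The flipped configuration has plain arms `(B,W,B,B,W)` -/

/-- The colours `(B,W,W,W,W)` are invariant under the reversal of the last four arms. [folklore] -/
theorem oneFour_mirrorPerm (j : Fin 5) :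
    (![true, false, false, false, false] : Fin 5 → Bool) (mirrorPerm j) = (![true, false, false, false, false] : Fin 5 → Bool) j := by
  fin_cases j <;> rfl

set_option maxHeartbeats 4000000 in
/-- **The double flip turns `(B,W,W,W,W)` into `(B,W,B,B,W)` at the radius `n - 1`**, from the tuple
`(rp m i₀, rp m k, rp m i₂, rp m i₃, rp m k')` for some `i₀ < k < i₂` and `i₃ < k' < i₀ + 6m`. [cite: Nolin2008, §5.1 Prop. 20 (arXiv 0711.4948: Prop. 19)] -/
theorem flip₂_mem (h : GadgetIdx m i) (hmn : m + 2 ≤ n) {ω : SiteConfig (Site 2)}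
    (hω : ω ∈ plainArms ![true, false, false, false, false] (sOf m i) m n) (hpaint : ω ∈ paint (coreOf (sOf m i) m) ∅) :
    ∃ k k', i 0 < k ∧ k < i 2 ∧ i 3 < k' ∧ k' < i 0 + 6 * m ∧
      flip₂ m n i ω ∈ plainArms ![true, false, true, true, false] (sOf m ![i 0, k, i 2, i 3, k']) m (n - 1) := by
  classical
  have hm := h.four_le; have hbase := h.base
  have h01 := h.lt01; have h12 := h.lt12; have h23 := h.lt23; have h34 := h.lt34; have h40 := h.lt40
  have hk : 1 ≤ m := by omega
  have nrp : ∀ j, triNorm (rp m j) = m := fun j => triNorm_rp hk j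
  set κ : Fin 5 → Bool := ![true, false, false, false, false] with hκ
  obtain ⟨y, w, hw, hdisj⟩ := hω
  -- arms of `ω`
  have hyn : ∀ j, triNorm (y j) = n := fun j => mem_triSphere_iff.1 (hw j).1
  have hsupp : ∀ j, ∀ v ∈ (w j).support, v = rp m (i j) ∨ ((m : ℤ) < triNorm v ∧ triNorm v ≤ n) := fun j => (hw j).2.2.1
  have hcolw : ∀ j, ∀ v ∈ (w j).support, (v ∈ ω ↔ κ j = true) := fun j => (hw j).2.2.2
  have hstart : ∀ j, rp m (i j) ∈ (w j).support := fun j => (w j).start_mem_support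
  have hdj : ∀ {a b : Fin 5}, a ≠ b → ∀ v, v ∈ (w a).support → v ∉ (w b).support := fun hab v hv hv' =>
    Finset.disjoint_left.1 (hdisj hab) (List.mem_toFinset.2 hv) (List.mem_toFinset.2 hv')
  have harm : ∀ j, PathIn triGraph {v | v ∈ (w j).support} (rp m (i j)) (y j) := fun j => PathIn.of_walk (w j) fun v hv => hv
  have hnormw : ∀ j, ∀ v ∈ (w j).support, (m : ℤ) ≤ triNorm v ∧ triNorm v ≤ n := fun j v hv => by
    rcases hsupp j v hv with rfl | h'
    · rw [nrp]; omega
    · omega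
  -- walk 1
  obtain ⟨P1, ⟨q, hqn, hF⟩, ⟨p, hpn, hT⟩, P6, P7, P8, -, cX⟩ := walk_package h hmn (κ := κ) rfl rfl rfl rfl w hw hdisj hpaint
  set c := col m n i ω with hc
  set X : Set (Site 2) := traversed c (inFace m (i 0)) (len c (inFace m (i 0))) with hX
  -- the mirrored data and walk 2
  set i' := mirrorIdx m i with hi'
  have h' : GadgetIdx m i' := gadgetIdx_mirrorIdx h
  set ωT := transposeCfg ω with hωT
  let φ : triGraph →g triGraph := triSwapIso.toEmbedding.toHom
  have hφinj : Function.Injective φ := transposeIso.injective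
  let y' : Fin 5 → Site 2 := fun j => transposeIso (y (mirrorPerm j))
  let w' : ∀ j, triGraph.Walk (sOf m i' j) (y' j) := fun j =>
    ((w (mirrorPerm j)).map φ).copy (transposeIso_sOf h j) rfl
  have hmem' : ∀ j v, v ∈ (w' j).support ↔ transposeIso v ∈ (w (mirrorPerm j)).support := fun j v => by
    show v ∈ (((w (mirrorPerm j)).map φ).copy _ rfl).support ↔ _
    rw [SimpleGraph.Walk.support_copy, SimpleGraph.Walk.support_map, List.mem_map]
    constructor
    · rintro ⟨u, hu, rfl⟩; show transposeIso (transposeIso u) ∈ _; rw [transposeIso_transposeIso]; exact hu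
    · intro hv; exact ⟨_, hv, transposeIso_transposeIso v⟩
  have hw' : ∀ j, y' j ∈ triSphere n ∧ (w' j).IsPath ∧
      (∀ v ∈ (w' j).support, v = sOf m i' j ∨ ((m : ℤ) < triNorm v ∧ triNorm v ≤ n)) ∧ IsColouredPath ωT (κ j) (w' j) := by
    intro j
    refine ⟨by rw [mem_triSphere_iff]; show triNorm (transposeIso _) = n; rw [triNorm_transposeIso]; exact hyn _, ?_,
      fun v hv => ?_, fun v hv => ?_⟩
    · show (((w (mirrorPerm j)).map φ).copy _ rfl).IsPath
      rw [SimpleGraph.Walk.isPath_copy]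
      exact (SimpleGraph.Walk.isPath_map_iff_of_injective hφinj).2 (hw _).2.1
    · rw [hmem'] at hv
      rcases hsupp _ _ hv with e | hh
      · left
        rw [← transposeIso_sOf h j]
        show v = transposeIso (rp m (i (mirrorPerm j)))
        rw [← e, transposeIso_transposeIso]
      · right; rw [triNorm_transposeIso] at hh; exact hh
    · rw [hmem'] at hv
      rw [mem_transposeCfg, hcolw _ _ hv, hκ, oneFour_mirrorPerm]
  have hdisj' : Pairwise fun a b => Disjoint (w' a).support.toFinset (w' b).support.toFinset := by
    intro a b hab
    rw [List.disjoint_toFinset_iff_disjoint]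
    intro v hva hvb
    rw [hmem'] at hva hvb
    exact hdj (fun e => hab (by revert e; fin_cases a <;> fin_cases b <;> decide)) _ hva hvb
  have hpaint' : ωT ∈ paint (coreOf (sOf m i') m) ∅ := (transpose_mem_src h ⟨y, w, hw, hdisj⟩ hpaint).2
  obtain ⟨P1', -, ⟨p', hpn', hT'⟩, -, P7', P8', -, cX'⟩ := walk_package h' hmn (κ := κ) rfl rfl rfl rfl w' hw' hdisj' hpaint'
  set c' := col m n i' ωT with hc'
  set X' : Set (Site 2) := traversed c' (inFace m (i' 0)) (len c' (inFace m (i' 0))) with hX'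
  -- colour facts
  have hcoreW : ∀ v, v ∈ coreRing m i → v ∉ ω := by
    rintro v ⟨hv, hvs⟩ hvω
    have hmem : v ∈ coreOf (sOf m i) m := by
      rw [coreOf, Finset.mem_sdiff, mem_triBall_iff]
      refine ⟨by rw [hv], fun hh => ?_⟩
      obtain ⟨j, -, hj⟩ := Finset.mem_image.1 hh
      exact hvs j hj.symm
    exact (hpaint v hmem).1 hvω
  have hcoreW' : ∀ v, v ∈ coreRing m i' → v ∉ ωT := by
    rintro v ⟨hv, hvs⟩ hvω
    have hmem : v ∈ coreOf (sOf m i') m := by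
      rw [coreOf, Finset.mem_sdiff, mem_triBall_iff]
      refine ⟨by rw [hv], fun hh => ?_⟩
      obtain ⟨j, -, hj⟩ := Finset.mem_image.1 hh
      exact hvs j hj.symm
    exact (hpaint' v hmem).1 hvω
  have cfalse : ∀ {x}, c x = some false → x ∈ ω ∧ x ∉ coreRing m i ∧ (m : ℤ) ≤ triNorm x ∧ triNorm x < n := fun hx => by
    obtain ⟨⟨h1, h2⟩, h3, h4⟩ := col_eq_some_false_iff.1 hx; exact ⟨h4, h3, h1, h2⟩
  have ctrue : ∀ {x}, c x = some true → x ∉ ω ∧ (m : ℤ) ≤ triNorm x ∧ triNorm x < n := fun hx => by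
    obtain ⟨⟨h1, h2⟩, h3⟩ := col_eq_some_true_iff.1 hx
    exact ⟨h3.elim (hcoreW _) id, h1, h2⟩
  have ctrue' : ∀ {x}, c' x = some true → transposeIso x ∉ ω ∧ (m : ℤ) ≤ triNorm x ∧ triNorm x < n := fun hx => by
    obtain ⟨⟨h1, h2⟩, h3⟩ := col_eq_some_true_iff.1 hx
    exact ⟨h3.elim (hcoreW' _) id, h1, h2⟩
  -- the second walk in the original frame
  set X₂ : Set (Site 2) := transposeIso '' X' with hX₂
  set T₂ : Set (Site 2) := transposeIso '' {x | c' x = some true ∧ x ∈ X'} with hT₂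
  have hb' : transposeIso (rp m (i' 0)) = rp m (i 0) := by
    have := transposeIso_sOf h 0
    change transposeIso (rp m (i 0)) = rp m (i' 0) at this
    rw [← this, transposeIso_transposeIso]
  have hb'1 : transposeIso (rp m (i' 0 + 1)) = rp m (i 0 - 1) := by
    rw [← transposeIso_pred h, transposeIso_transposeIso]
  have hT₂path : PathIn triGraph T₂ (rp m (i 0 - 1)) (transposeIso p') := by
    have := pathIn_map_iso triSwapIso hT'
    rw [triSwapIso_apply, hb'1] at this
    exact this
  have hP8₂ : ∀ z ∈ T₂, PathIn triGraph T₂ (rp m (i 0 - 1)) z := by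
    rintro _ ⟨x, ⟨hcx, hxX⟩, rfl⟩
    have := pathIn_map_iso triSwapIso (P8' x hxX hcx)
    rw [triSwapIso_apply, hb'1] at this
    exact this
  have hT₂W : ∀ z ∈ T₂, z ∉ ω ∧ (m : ℤ) ≤ triNorm z ∧ triNorm z < n := by
    rintro _ ⟨x, ⟨hcx, -⟩, rfl⟩
    obtain ⟨h1, h2, h3⟩ := ctrue' hcx
    exact ⟨h1, by rw [triNorm_transposeIso]; exact h2, by rw [triNorm_transposeIso]; exact h3⟩
  -- the second walk avoids the arms of `s₁, s₂, s₃`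
  have P1₂ : ∀ j, j ≠ 0 → j ≠ 4 → ∀ z ∈ (w j).support, z ∉ X₂ := by
    intro j hj0 hj4 z hz ⟨x, hxX, hxz⟩
    obtain ⟨j', hj', hjp⟩ : ∃ j', j' ≠ 0 ∧ j' ≠ 1 ∧ mirrorPerm j' = j := by
      fin_cases j
      · exact absurd rfl hj0
      · exact ⟨4, by decide, by decide, rfl⟩
      · exact ⟨3, by decide, by decide, rfl⟩
      · exact ⟨2, by decide, by decide, rfl⟩
      · exact absurd rfl hj4
    refine P1' j' hj' hjp.1 x ((hmem' j' x).2 ?_) hxX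
    rw [hjp.2, hxz]; exact hz
  -- arm sites of `s₂, s₃` up to the radius `n - 1` are flipped
  set ω₂ := flip₂ m n i ω with hω₂
  have hXN : ∀ x ∈ X, x ∈ Nboth m n i ω := by
    intro x hx
    have hnx := (col_eq_none_iff (ω := ω) (m := m) (n := n) (i := i) (v := x)).not.1 (cX x hx)
    push Not at hnx
    unfold Nboth N₁
    by_cases hxA : x ∈ Afl m n i
    · exact Finset.mem_union_left _ (Finset.mem_union_left _ (Finset.mem_union_left _ (mem_examined_of_traversed le_rfl hx hxA)))
    · exact Finset.mem_union_right _ (Finset.mem_sdiff.2 ⟨mem_triBall_iff.2 (by omega), hxA⟩)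
  have hX₂N : ∀ z ∈ X₂, z ∈ Nboth m n i ω := by
    rintro _ ⟨x, hxX, rfl⟩
    have hnx := (col_eq_none_iff (ω := ωT) (m := m) (n := n) (i := i') (v := x)).not.1 (cX' x hxX)
    push Not at hnx
    unfold Nboth N₂ N₁
    by_cases hxA : x ∈ Afl m n i'
    · refine Finset.mem_union_left _ (Finset.mem_union_right _ (Finset.mem_image_of_mem _ ?_))
      exact Finset.mem_union_left _ (mem_examined_of_traversed le_rfl hxX hxA)
    · refine Finset.mem_union_right _ (Finset.mem_sdiff.2 ⟨mem_triBall_iff.2 (by rw [triNorm_transposeIso]; omega), fun hA => hxA ?_⟩)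
      rw [mem_Afl_mirror h]; exact hA
  have keep : ∀ x ∈ X, (x ∈ ω₂ ↔ x ∈ ω) := fun x hx => mem_stopFlip_iff_of_mem (hXN x hx)
  have keep₂ : ∀ z ∈ X₂, (z ∈ ω₂ ↔ z ∈ ω) := fun z hz => mem_stopFlip_iff_of_mem (hX₂N z hz)
  have flipArm : ∀ j, j ≠ 0 → j ≠ 1 → j ≠ 4 → ∀ z ∈ (w j).support, triNorm z ≤ ((n - 1 : ℕ) : ℤ) → (z ∈ ω₂ ↔ z ∉ ω) := by
    intro j hj0 hj1 hj4 z hz hzn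
    have hib := h.i_bounds j
    have hj23 : i 2 ≤ i j ∧ i j ≤ i 3 := by
      fin_cases j <;> simp at hj0 hj1 hj4 ⊢ <;> omega
    have hzA : z ∈ Afl m n i := by
      rw [mem_Afl]
      rcases hsupp j z hz with rfl | ⟨h1, h2⟩
      · exact ⟨⟨by rw [nrp], hzn⟩, fun ⟨_, hh⟩ => hh j rfl⟩
      · exact ⟨⟨by omega, hzn⟩, fun ⟨hh, _⟩ => by omega⟩
    have hzi : ∀ k, rp m k = z → i 0 ≤ k → k < i 0 + 6 * m → k = i j := by
      intro k e hk1 hk2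
      rcases hsupp j z hz with e' | ⟨h1, -⟩
      · rw [e'] at e
        by_contra hne
        rcases lt_or_gt_of_ne hne with hlt | hgt
        · exact rp_ne_rp_of_lt hk hlt (by omega) e
        · exact rp_ne_rp_of_lt hk hgt (by omega) e.symm
      · rw [← e, nrp] at h1; omega
    refine mem_stopFlip_iff_of_mem_sdiff (Finset.mem_filter.1 hzA).1 fun hN => ?_
    unfold Nboth N₂ N₁ at hN
    rcases Finset.mem_union.1 hN with hN | hN
    · rcases Finset.mem_union.1 hN with hN | hN
      · rcases Finset.mem_union.1 hN with hN | hN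
        · exact P1 j hj0 hj1 z hz (traversed_of_mem_examined hN)
        · obtain ⟨h1, -⟩ := Finset.mem_inter.1 hN
          rcases Finset.mem_insert.1 h1 with e | e
          · exact hdj hj0 _ hz (e ▸ hstart 0)
          · rw [Finset.mem_singleton] at e
            have := hzi (i 0 + 1) e.symm (by omega) (by omega)
            omega
      · obtain ⟨x, hx, hxz⟩ := Finset.mem_image.1 hN
        rcases Finset.mem_union.1 hx with hx | hx
        · exact P1₂ j hj0 hj4 z hz ⟨x, traversed_of_mem_examined hx, hxz⟩
        · obtain ⟨h1, -⟩ := Finset.mem_inter.1 hx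
          rcases Finset.mem_insert.1 h1 with e | e
          · rw [e, hb'] at hxz
            exact hdj hj0 _ (hxz ▸ hz) (hstart 0)
          · rw [Finset.mem_singleton] at e
            rw [e, hb'1] at hxz
            have := hzi (i 0 - 1 + 6 * m) (by rw [rp_add_period]; exact hxz) (by omega) (by omega)
            omega
    · exact (Finset.mem_sdiff.1 hN).2 hzA
  -- the last ring sites of the two white chains
  obtain ⟨t, t₁, htC, htS, -, htt₁, hrest⟩ := hT.last_exit (C := {v | triNorm v ≤ (m : ℤ)})
    (by show triNorm (rp m (i 0 + 1)) ≤ (m : ℤ); rw [nrp]) (by show ¬ triNorm p ≤ (m : ℤ); omega)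
  have htm : triNorm t = m := le_antisymm htC (ctrue htS.1).2.1
  obtain ⟨k, hk1, hk2, rfl⟩ := P7 t htS.2 htS.1 htm
  obtain ⟨u, u₁, huC, huS, -, huu₁, hrest₂⟩ := hT₂path.last_exit (C := {v | triNorm v ≤ (m : ℤ)})
    (by show triNorm (rp m (i 0 - 1)) ≤ (m : ℤ); rw [nrp]) (by show ¬ triNorm (transposeIso p') ≤ (m : ℤ); rw [triNorm_transposeIso]; omega)
  have hum : triNorm u = m := le_antisymm huC (hT₂W u huS).2.1
  obtain ⟨k', hk'1, hk'2, hu⟩ : ∃ k', i 3 < k' ∧ k' < i 0 + 6 * m ∧ u = rp m k' := by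
    obtain ⟨x, ⟨hcx, hxX⟩, rfl⟩ := huS
    obtain ⟨k₁, hk₁1, hk₁2, rfl⟩ := P7' x hxX hcx (by rw [← triNorm_transposeIso]; exact hum)
    obtain ⟨k', h1, h2, e⟩ := exists_idx_of_mirror h hk₁1 hk₁2
    exact ⟨k', h1, h2, by rw [← e, transposeIso_transposeIso]⟩
  subst hu
  refine ⟨k, k', hk1, hk2, hk'1, hk'2, ?_⟩
  -- truncated arms of `s₂, s₃`
  have trunc : ∀ j, ∃ f, triNorm f = (n : ℤ) - 1 ∧
      PathIn triGraph ({v | v ∈ (w j).support} ∩ {v | triNorm v ≤ ((n - 1 : ℕ) : ℤ)}) (rp m (i j)) f := by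
    intro j
    obtain ⟨f, hf, pf⟩ := Gadget.exists_pathIn_trunc (R := n - 1) (harm j) (by rw [nrp]; omega) (by rw [hyn]; omega)
    exact ⟨f, by rw [hf]; omega, pf⟩
  obtain ⟨f2, hf2, pf2⟩ := trunc 2
  obtain ⟨f3, hf3, pf3⟩ := trunc 3
  -- the two white chains are disjoint: `s₀⁺` and `s₀⁻` are separated by the arms of `s₀` and `s₂`
  have hT₁T₂ : ∀ z, c z = some true → z ∈ X → z ∉ T₂ := by
    intro z hcz hzX hzT
    have hp1 := P8 z hzX hcz
    have hp2 := hP8₂ z hzT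
    refine rim_separation (jA := i 0) (jB := i 2) (by omega) (by omega) (by omega) (w 0) (w 2) (hsupp 0) (hsupp 2) (hw 0).2.1 (hw 2).2.1
      (hyn 0) (hyn 2) (j := i 0 + 1) (j' := i 0 - 1 + 6 * m) (by omega) (by omega) (by omega) (by omega)
      (S := {x | c x = some true ∧ x ∈ X} ∪ T₂) ?_ ?_
    · rintro v (⟨hv, hvX⟩ | hv)
      · obtain ⟨hvω, h1, h2⟩ := ctrue hv
        exact ⟨h1, by omega, fun h0 => hvω ((hcolw 0 v h0).2 rfl), fun h2' => P1 2 (by decide) (by decide) v h2' hvX⟩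
      · obtain ⟨hvω, h1, h2⟩ := hT₂W v hv
        refine ⟨h1, by omega, fun h0 => hvω ((hcolw 0 v h0).2 rfl), fun h2' => P1₂ 2 (by decide) (by decide) v h2' ?_⟩
        obtain ⟨x, ⟨-, hxX⟩, rfl⟩ := hv
        exact ⟨x, hxX, rfl⟩
    · rw [rp_add_period]
      exact (hp1.mono Set.subset_union_left).trans (hp2.mono Set.subset_union_right).symm
  -- the five sets
  let S : Fin 5 → Set (Site 2) := ![{x | c x = some false ∧ x ∈ X},
    {rp m k} ∪ ({x | c x = some true ∧ x ∈ X} \ {v | triNorm v ≤ (m : ℤ)}),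
    {v | v ∈ (w 2).support} ∩ {v | triNorm v ≤ ((n - 1 : ℕ) : ℤ)},
    {v | v ∈ (w 3).support} ∩ {v | triNorm v ≤ ((n - 1 : ℕ) : ℤ)},
    {rp m k'} ∪ (T₂ \ {v | triNorm v ≤ (m : ℤ)})]
  have S1 : S 1 = {rp m k} ∪ ({x | c x = some true ∧ x ∈ X} \ {v | triNorm v ≤ (m : ℤ)}) := rfl
  have S4 : S 4 = {rp m k'} ∪ (T₂ \ {v | triNorm v ≤ (m : ℤ)}) := rfl
  have S1X : ∀ v ∈ S 1, c v = some true ∧ v ∈ X := by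
    rintro v (hv | ⟨hv, -⟩)
    · rw [Set.mem_singleton_iff] at hv; rw [hv]; exact htS
    · exact hv
  have S4T : ∀ v ∈ S 4, v ∈ T₂ := by
    rintro v (hv | ⟨hv, -⟩)
    · rw [Set.mem_singleton_iff] at hv; rw [hv]; exact huS
    · exact hv
  have T₂X₂ : T₂ ⊆ X₂ := by rintro _ ⟨x, ⟨-, hx⟩, rfl⟩; exact ⟨x, hx, rfl⟩
  have armX : ∀ j, j ≠ 0 → j ≠ 1 → ∀ v ∈ {v | v ∈ (w j).support} ∩ {v | triNorm v ≤ ((n - 1 : ℕ) : ℤ)}, v ∉ X :=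
    fun j hj0 hj1 v hv => P1 j hj0 hj1 v hv.1
  have armX₂ : ∀ j, j ≠ 0 → j ≠ 4 → ∀ v ∈ {v | v ∈ (w j).support} ∩ {v | triNorm v ≤ ((n - 1 : ℕ) : ℤ)}, v ∉ X₂ :=
    fun j hj0 hj4 v hv => P1₂ j hj0 hj4 v hv.1
  refine mem_plainArms_of_pathIn S ?_ (y := ![q, p, f2, f3, transposeIso p']) ?_ ?_ ?_ ?_
  · have d01 : Disjoint (S 0) (S 1) := Set.disjoint_left.2 fun v h0 h1 => by
      change c v = some false ∧ v ∈ X at h0; have := (S1X v h1).1; rw [h0.1] at this; exact absurd this (by simp)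
    have d04 : Disjoint (S 0) (S 4) := Set.disjoint_left.2 fun v h0 h4 => by
      change c v = some false ∧ v ∈ X at h0; exact (hT₂W v (S4T v h4)).1 (cfalse h0.1).1
    have d14 : Disjoint (S 1) (S 4) := Set.disjoint_left.2 fun v h1 h4 => hT₁T₂ v (S1X v h1).1 (S1X v h1).2 (S4T v h4)
    have d0a : ∀ j, j ≠ 0 → j ≠ 1 → Disjoint (S 0) ({v | v ∈ (w j).support} ∩ {v | triNorm v ≤ ((n - 1 : ℕ) : ℤ)}) :=
      fun j hj0 hj1 => Set.disjoint_left.2 fun v h0 ha => armX j hj0 hj1 v ha (by change c v = some false ∧ v ∈ X at h0; exact h0.2)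
    have d1a : ∀ j, j ≠ 0 → j ≠ 1 → Disjoint (S 1) ({v | v ∈ (w j).support} ∩ {v | triNorm v ≤ ((n - 1 : ℕ) : ℤ)}) :=
      fun j hj0 hj1 => Set.disjoint_left.2 fun v h1 ha => armX j hj0 hj1 v ha (S1X v h1).2
    have d4a : ∀ j, j ≠ 0 → j ≠ 4 → Disjoint (S 4) ({v | v ∈ (w j).support} ∩ {v | triNorm v ≤ ((n - 1 : ℕ) : ℤ)}) :=
      fun j hj0 hj4 => Set.disjoint_left.2 fun v h4 ha => armX₂ j hj0 hj4 v ha (T₂X₂ (S4T v h4))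
    have daa : ∀ a b : Fin 5, a ≠ b → Disjoint ({v | v ∈ (w a).support} ∩ {v | triNorm v ≤ ((n - 1 : ℕ) : ℤ)})
        ({v | v ∈ (w b).support} ∩ {v | triNorm v ≤ ((n - 1 : ℕ) : ℤ)}) :=
      fun a b hab => Set.disjoint_left.2 fun v ha hb => hdj hab v ha.1 hb.1
    intro a b hab
    fin_cases a <;> fin_cases b <;> first
      | exact absurd rfl hab
      | exact d01 | exact d01.symm | exact d04 | exact d04.symm | exact d14 | exact d14.symm
      | exact d0a _ (by decide) (by decide) | exact (d0a _ (by decide) (by decide)).symm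
      | exact d1a _ (by decide) (by decide) | exact (d1a _ (by decide) (by decide)).symm
      | exact d4a _ (by decide) (by decide) | exact (d4a _ (by decide) (by decide)).symm
      | exact daa _ _ (by decide)
  · intro j; fin_cases j
    · show triNorm q = ((n - 1 : ℕ) : ℤ); omega
    · show triNorm p = ((n - 1 : ℕ) : ℤ); omega
    · show triNorm f2 = ((n - 1 : ℕ) : ℤ); omega
    · show triNorm f3 = ((n - 1 : ℕ) : ℤ); omega
    · show triNorm (transposeIso p') = ((n - 1 : ℕ) : ℤ); rw [triNorm_transposeIso]; omega
  · intro j; fin_cases j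
    · exact hF
    · show PathIn triGraph (S 1) (rp m k) p
      rw [S1]
      exact PathIn.trans (PathIn.of_adj (Or.inl rfl) (Or.inr hrest.left_mem) htt₁) (hrest.mono Set.subset_union_right)
    · exact pf2
    · exact pf3
    · show PathIn triGraph (S 4) (rp m k') (transposeIso p')
      rw [S4]
      exact PathIn.trans (PathIn.of_adj (Or.inl rfl) (Or.inr hrest₂.left_mem) huu₁) (hrest₂.mono Set.subset_union_right)
  · intro j v hv
    fin_cases j
    · change c v = some false ∧ v ∈ X at hv
      obtain ⟨-, -, h1, h2⟩ := cfalse hv.1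
      rcases (lt_or_eq_of_le h1) with hlt | heq
      · right; exact ⟨hlt, by omega⟩
      · left; exact P6 v hv.2 hv.1 heq.symm
    · change v ∈ S 1 at hv
      rcases hv with hv | ⟨hv, hvC⟩
      · left; exact hv
      · right
        obtain ⟨-, h1, h2⟩ := ctrue hv.1
        change ¬ triNorm v ≤ (m : ℤ) at hvC
        exact ⟨by omega, by omega⟩
    · change v ∈ (w 2).support ∧ triNorm v ≤ ((n - 1 : ℕ) : ℤ) at hv
      rcases hsupp 2 v hv.1 with e | ⟨h1, -⟩
      · left; exact e
      · right; exact ⟨h1, hv.2⟩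
    · change v ∈ (w 3).support ∧ triNorm v ≤ ((n - 1 : ℕ) : ℤ) at hv
      rcases hsupp 3 v hv.1 with e | ⟨h1, -⟩
      · left; exact e
      · right; exact ⟨h1, hv.2⟩
    · change v ∈ S 4 at hv
      rcases hv with hv | ⟨hv, hvC⟩
      · left; exact hv
      · right
        obtain ⟨-, h1, h2⟩ := hT₂W v hv
        change ¬ triNorm v ≤ (m : ℤ) at hvC
        exact ⟨by omega, by omega⟩
  · intro j v hv
    fin_cases j
    · change c v = some false ∧ v ∈ X at hv
      exact iff_of_true ((keep v hv.2).2 (cfalse hv.1).1) rfl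
    · have h1 := S1X v hv
      exact iff_of_false (fun hh => (ctrue h1.1).1 ((keep v h1.2).1 hh)) Bool.false_ne_true
    · change v ∈ (w 2).support ∧ triNorm v ≤ ((n - 1 : ℕ) : ℤ) at hv
      have := flipArm 2 (by decide) (by decide) (by decide) v hv.1 hv.2
      exact iff_of_true (this.2 fun hh => by have := (hcolw 2 v hv.1).1 hh; exact Bool.false_ne_true this) rfl
    · change v ∈ (w 3).support ∧ triNorm v ≤ ((n - 1 : ℕ) : ℤ) at hv
      have := flipArm 3 (by decide) (by decide) (by decide) v hv.1 hv.2
      exact iff_of_true (this.2 fun hh => by have := (hcolw 3 v hv.1).1 hh; exact Bool.false_ne_true this) rfl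
    · have h4 := S4T v hv
      exact iff_of_false (fun hh => (hT₂W v h4).1 ((keep₂ v (T₂X₂ h4)).1 hh)) Bool.false_ne_true

end InnerFlip2

end Literature.Probability.Percolation

end
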